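import Literature.Computability.AlgebraicComplexity.MS2001KempfStabilityHolds
import Literature.Computability.AlgebraicComplexity.MS2001TracePowerRemark
import Mathlib.LinearAlgebra.Matrix.Transvection
import Mathlib.LinearAlgebra.Matrix.Kronecker
import HarnessLib

/-!
# GCT I §4.1, closing Remark: the Thm. 4.6 analogue — `trace(Y^m)` is STABLE (closed `SL_{m²}`-orbit)
# over every algebraically closed field with `m ≠ 0` in it (`m ≥ 2`), by Kempf's criterion

Topic `Computability/AlgebraicComplexity`. Cell `val-lit`, row MS2001-A (K. Mulmuley, M. Sohoni,
*Geometric complexity theory I*, SIAM J. Comput. 31 (2001) 496–526), §4.1 closing Remark (AV p.16,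
all.txt L1122–1124; text of record `run/shared/lean/pub/val-lit/bip/texts/MS2001-authorversion/`):

> "Remark: The role of the determinant in this section can also be played by the trace:
> specifically, the analogues of Proposition 4.1 and Theorem 4.6 hold for `trace(Y^m)` as well."

Thm. 4.6 (AV p.15): "`det(Y)` is stable" — closed `SL_{m²}`-orbit, the tree's `IsPolystable`
(`MS2001_thm_4_6_holds`, every algebraically closed field, by Kempf's criterion). The companion file
`MS2001TracePowerRemark.lean` types `tracePow F n m = trace(Y^m)` and shows that the announced
analogue "(4.6-tr) `trace(Y^m)` is stable" FAILS for `m = char F`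
(`MS2001_rem_4_1_trace_thm_4_6_analogue_false_charP`) and holds for `m = 2` over `ℂ`. This file
proves the POSITIVE statement in the remaining range:

* `MS2001_rem_4_1_trace_thm_4_6_analogue` — for every algebraically closed field `K` and every
  `m ≥ 2` with `(m : K) ≠ 0`, `IsPolystable (tracePow K m m)`: the `SL_{m²}(K)`-orbit of
  `trace(Y^m)` is Zariski closed. In particular over every algebraically closed field of
  characteristic `0` (`…_of_charZero`) and over `ℂ` (`…_complex`), for all `m ≥ 2`.

## Proof (ours — the print says only "the analogue of Theorem 4.6 holds"; Mulmuley–Sohoni prove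
## Thm. 4.6 by Kempf's criterion, and so do we)

Kempf (1978, Cor. 4.4) in the tree's form for `SL_σ` on forms (`KempfOptimalParabolicSL.lean`,
programme "Kempf" of the cell): if the form `v` is NOT polystable there is an optimal pair
`(h, a)` — `h ∈ SL_σ`, `a ∈ ℝ^σ` a non-zero weight vector with `∑ a = 0` — which is ADMISSIBLE
(every monomial `x^d` of `h · v` has `⟨a, d⟩ ≥ 0`: the limit `t → 0` exists) and whose whole weight
flag `F(h, a, r) = {x : a_i < r ⇒ (h x)_i = 0}` is mapped into itself by the stabiliser of `v`
(§1, `exists_isAdm_forall_weightFlag_stable_of_not_isPolystable`; the tree exported only one step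
of the flag, without the admissibility). For `v = trace(Y^m)` the stabiliser contains the
conjugations `Y ↦ T Y T⁻¹`, `T ∈ SL_m` (as substitution matrices `Pᵀ ⊗ Q` of determinant `1`,
§2–§3), so every step of the flag is a conjugation-invariant subspace of `M_m(K)`, hence (§4,
`submodule_eq_of_conjVec_mem`: transvections suffice, any infinite field, any `m ≥ 1`) one of
`0`, `K · 1`, `sl_m = {trace = 0}`, `M_m`. Since `K · 1 ⊄ sl_m` (`m ≠ 0` in `K`) and
`sl_m ⊄ K · 1` (`m ≥ 2`), the flag has exactly one proper step, `a` takes exactly two values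
`α < 0 < β`, and either (A) the step is the line `K · 1` — one coordinate of weight `β`, and
admissibility forces every monomial of `h · v` to contain that coordinate, i.e. `trace(Y^m)`
vanishes on a hyperplane of `M_m`, which it does not (§5, `exists_trace_pow_ne_zero`: an
idempotent of trace `1`, or the cyclic shift, inside any given hyperplane); or (B) the step is
`sl_m` — one coordinate of weight `α`, admissibility forces `h · v` not to involve it, i.e.
`trace((Y + c·1)^m) = trace(Y^m)` for all `c`, false at `Y = 0`, `c = 1` (`trace(1) = m ≠ 0`).
SHARPNESS: for `m = char K` the statement is false (companion file); `m = 1` is the trivial group.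

Everything is a theorem except the plumbing definitions `adSubst`, `conjVec`, `vecE`, `vecI`,
`trLin`, `shiftMat` (bodies, no facts, no instances, no `sorry`). Honest framing: classical
geometric invariant theory on an unnumbered remark; nothing here bears on any separation
(`VP ≠ VNP` is NOT proved).

## References

* [MulmuleySohoniSIAM2001] K. Mulmuley, M. Sohoni, *Geometric complexity theory I*, SIAM J.
  Comput. 31 (2001) 496–526, §4.1 closing Remark (AV p.16, all.txt L1122–1124); Thm. 4.6 and its
  proof by Kempf's criterion (AV p.15, L935–950).
* [Kempf1978] G. R. Kempf, *Instability in invariant theory*, Ann. of Math. (2) 108 (1978), Thm.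
  2.2, Thm. 3.4, Cor. 4.4 (tree: `KempfOptimalParabolicSL.lean`, `MS2001KempfStabilityHolds.lean`).
-/

noncomputable section

open MvPolynomial
open scoped Matrix

namespace Literature.Computability.AlgebraicComplexity

open Literature.LinearAlgebra.Matrix

/-! ## §1. Kempf's corollary with the admissible pair and the whole flag -/

section Kempf

variable {K : Type} [Field K] {σ : Type} [Fintype σ] [DecidableEq σ]

/-- **Kempf's theorem (1978, Thm. 3.4 / Cor. 4.4) for `SL_σ` acting on forms, with the
admissibility retained.** If the form `v` of degree `D` over an algebraically closed field is NOT
polystable, there are `h ∈ SL_σ(K)` and a non-zero real weight vector `a` with `∑ a = 0` such that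
(i) `(h, a)` is admissible — every monomial `x^d` of `h · v` satisfies `∑ a_i d_i ≥ 0` (the virtual
one-parameter subgroup `h⁻¹ diag(t^a) h` has a limit on `v`), and (ii) EVERY step
`F(h, a, r) = {x : ∀ i, a_i < r → (h x)_i = 0}` of its weight flag is mapped into itself by every
`γ ∈ SL_σ(K)` fixing `v` (`Stab(v) ⊆ P(λ)`). The tree's
`exists_submodule_stable_of_not_isPolystable` exports one proper step; this is the same proof
(`TestSystem.exists_isOpt`, `IsOpt.mul_stabilizer`, `IsOpt.flag_eq`, Bruhat input
`exists_sl_bruhat_flagTransport`) keeping the optimal pair. [cite: Kempf1978, Thm. 3.4, Cor. 4.4] -/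
theorem exists_isAdm_forall_weightFlag_stable_of_not_isPolystable [IsAlgClosed K]
    {v : MvPolynomial σ K} {D : ℕ} (hv : v.IsHomogeneous D) (hnp : ¬ IsPolystable v) :
    ∃ (h : Matrix.SpecialLinearGroup σ K) (a : σ → ℝ), ∑ i, a i = 0 ∧ a ≠ 0 ∧
      IsAdm (linSubst σ K (h : Matrix σ σ K) v) a ∧
      ∀ (r : ℝ) (γ : Matrix.SpecialLinearGroup σ K),
        linSubst σ K (γ : Matrix σ σ K) v = v →
        ∀ x ∈ (Submodule.pi {i : σ | a i < r} (fun _ => (⊥ : Submodule K K))).comap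
            (h : Matrix σ σ K).mulVecLin,
          (γ : Matrix σ σ K).mulVec x ∈
            (Submodule.pi {i : σ | a i < r} (fun _ => (⊥ : Submodule K K))).comap
              (h : Matrix σ σ K).mulVecLin := by
  classical
  obtain ⟨Q, hQD, hQcl, hQ⟩ := exists_isPolystable_mem_zariskiClosure hv
  obtain ⟨T⟩ := nonempty_testSystem (D := D) Q
  obtain ⟨h, a, hopt⟩ := T.exists_isOpt hQ hQD hv hnp hQcl
  have ha0 : a ≠ 0 := by
    intro h0
    have h1 := hopt.1.2.2
    rw [h0] at h1
    simp at h1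
  refine ⟨h, a, hopt.1.1, ha0, hopt.1.2.1, fun r γ hγ x hx => ?_⟩
  have hopt' : T.IsOpt v (h * γ) a := hopt.mul_stabilizer T γ hγ
  obtain ⟨p₂, w, p₁, π, hp₂, hp₂i, hp₁, hp₁i, hw, hwi, hflagw, hg⟩ :=
    exists_sl_bruhat_flagTransport a a (h * γ * h⁻¹)
  have heq := hopt.flag_eq T hQ hQD hv hnp hQcl hopt' p₂ w p₁ π hp₂ hp₂i hp₁ hp₁i hw hwi hflagw hg r
  rw [Matrix.SpecialLinearGroup.coe_mul] at heq
  exact mulVec_mem_weightFlag_of_eq heq.symm hx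

end Kempf

namespace MS2001TracePowPolystable

/-! ## §2. Evaluating `trace(Y^m)`; the substitutions `Y ↦ P Y Q` -/

section Subst

variable {K : Type} [Field K] {n : ℕ}

/-- `trace(Y^m)` at the matrix `A` is `trace(A^m)`. [folklore] -/
private theorem eval_tracePow (A : Matrix (Fin n) (Fin n) K) (m : ℕ) :
    eval (fun p : Fin n × Fin n => A p.1 p.2) (tracePow K n m) = (A ^ m).trace := by
  have h1 : (MvPolynomial.eval fun p : Fin n × Fin n => A p.1 p.2).mapMatrix
      ((Matrix.mvPolynomialX (Fin n) (Fin n) K) ^ m) = A ^ m := by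
    rw [map_pow, Matrix.mvPolynomialX_mapMatrix_eval]
  rw [tracePow, ← h1, RingHom.mapMatrix_apply]
  simp [Matrix.trace, Matrix.diag, map_sum]

/-- An algebra map commutes with the trace of a power. [folklore] -/
private theorem algHom_trace_pow {R S F : Type*} [CommRing R] [CommRing S] [CommSemiring F]
    [Algebra F R] [Algebra F S] {m : Type*} [Fintype m] [DecidableEq m] (φ : R →ₐ[F] S)
    (M : Matrix m m R) (k : ℕ) : φ ((M ^ k).trace) = ((M.map φ) ^ k).trace := by
  have h : (M ^ k).map φ = (M.map φ) ^ k := by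
    rw [← AlgHom.mapMatrix_apply, map_pow, AlgHom.mapMatrix_apply]
  rw [← h]
  simp [Matrix.trace, Matrix.diag, map_sum]

/-- The substitution matrix of `Y ↦ P Y Q` on the `n²` entries of `Y`: column `(i,j)` holds the
coefficients of `(P Y Q)_{ij} = ∑ P_{ia} y_{ab} Q_{bj}`, i.e. `S_{(a,b),(i,j)} = P_{ia} Q_{bj}`
(`= (Pᵀ ⊗ Q)_{(a,b),(i,j)}`). [folklore] -/
def adSubst (P Q : Matrix (Fin n) (Fin n) K) : Matrix (Fin n × Fin n) (Fin n × Fin n) K :=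
  fun p v => P v.1 p.1 * Q p.2 v.2

/-- `adSubst P Q` is the Kronecker product `Pᵀ ⊗ Q`. [folklore] -/
private theorem adSubst_eq_kronecker (P Q : Matrix (Fin n) (Fin n) K) :
    adSubst P Q = Matrix.kroneckerMap (· * ·) Pᵀ Q := by
  ext ⟨a, b⟩ ⟨i, j⟩
  rfl

/-- `det (adSubst P Q) = (det P · det Q)^n`. [folklore] -/
private theorem det_adSubst (P Q : Matrix (Fin n) (Fin n) K) :
    (adSubst P Q).det = (P.det * Q.det) ^ n := by
  rw [adSubst_eq_kronecker, Matrix.det_kronecker, Matrix.det_transpose, Fintype.card_fin, mul_pow]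

/-- The substitution on the variable matrix: `Y ↦ P Y Q`. [folklore] -/
private theorem mvPolynomialX_map_linSubst_adSubst (P Q : Matrix (Fin n) (Fin n) K) :
    (Matrix.mvPolynomialX (Fin n) (Fin n) K).map (linSubst (Fin n × Fin n) K (adSubst P Q)) =
      P.map C * Matrix.mvPolynomialX (Fin n) (Fin n) K * Q.map C := by
  ext i j
  have hR : (P.map C * Matrix.mvPolynomialX (Fin n) (Fin n) K * Q.map C :
      Matrix (Fin n) (Fin n) (MvPolynomial (Fin n × Fin n) K)) i j =
      ∑ b, ∑ a, C (P i a) * X (a, b) * C (Q b j) := by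
    simp only [Matrix.mul_apply, Matrix.map_apply, Matrix.mvPolynomialX_apply, Finset.sum_mul]
  have hL : ((Matrix.mvPolynomialX (Fin n) (Fin n) K).map
      (linSubst (Fin n × Fin n) K (adSubst P Q))) i j = ∑ b, ∑ a, C (P i a) * X (a, b) * C (Q b j) := by
    rw [Matrix.map_apply, Matrix.mvPolynomialX_apply, linSubst_X, Fintype.sum_prod_type_right]
    refine Finset.sum_congr rfl fun b _ => Finset.sum_congr rfl fun a _ => ?_
    simp only [adSubst, smul_eq_C_mul, map_mul]
    ring
  rw [hL, hR]

/-- **`trace((P Y Q)^m) = trace(Y^m)` when `Q P = 1`**: the substitution `Y ↦ P Y Q` fixes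
`trace(Y^m)`. [folklore] -/
private theorem linSubst_adSubst_tracePow {P Q : Matrix (Fin n) (Fin n) K} (hQP : Q * P = 1) (m : ℕ) :
    linSubst (Fin n × Fin n) K (adSubst P Q) (tracePow K n m) = tracePow K n m := by
  rw [tracePow, algHom_trace_pow, mvPolynomialX_map_linSubst_adSubst]
  set X := Matrix.mvPolynomialX (Fin n) (Fin n) K
  set P' : Matrix (Fin n) (Fin n) (MvPolynomial (Fin n × Fin n) K) := P.map C with hP'
  set Q' : Matrix (Fin n) (Fin n) (MvPolynomial (Fin n × Fin n) K) := Q.map C with hQ'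
  have hQP' : Q' * P' = 1 := by
    rw [hP', hQ', ← Matrix.map_mul, hQP, Matrix.map_one C (map_zero C) (map_one C)]
  rcases m with _ | k
  · simp
  · have hpow : ∀ k : ℕ, (P' * X * Q') ^ (k + 1) = P' * X ^ (k + 1) * Q' := by
      intro k
      induction k with
      | zero => rw [zero_add, pow_one, pow_one]
      | succ k ih =>
        rw [pow_succ, ih, pow_succ X (k + 1)]
        calc P' * X ^ (k + 1) * Q' * (P' * X * Q')
            = P' * X ^ (k + 1) * (Q' * P') * X * Q' := by simp only [Matrix.mul_assoc]
          _ = P' * (X ^ (k + 1) * X) * Q' := by rw [hQP', Matrix.mul_one]; simp only [Matrix.mul_assoc]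
    rw [hpow, Matrix.trace_mul_cycle, hQP', Matrix.one_mul]

/-- The action of `adSubst P Q` on coefficient vectors: `x ↦ Pᵀ X Qᵀ` (`X_{ab} = x (a, b)`).
[folklore] -/
private theorem adSubst_mulVec (P Q : Matrix (Fin n) (Fin n) K) (x : Fin n × Fin n → K)
    (k l : Fin n) :
    (adSubst P Q).mulVec x (k, l) = (Pᵀ * Matrix.of (fun a b => x (a, b)) * Qᵀ) k l := by
  rw [Matrix.mulVec, dotProduct, Fintype.sum_prod_type]
  simp only [Matrix.mul_apply, Matrix.transpose_apply, Matrix.of_apply, Finset.sum_mul, adSubst]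
  rw [Finset.sum_comm]
  refine Finset.sum_congr rfl fun b _ => Finset.sum_congr rfl fun a _ => ?_
  ring

end Subst

/-! ## §3. Conjugation by transvections as an element of the stabiliser of `trace(Y^m)` -/

section Transvection

variable {K : Type} [Field K] {n : ℕ}

/-- The coefficient vector of `T X T⁻¹` for the transvection `T = 1 + t E_{ij}`, `T⁻¹ = 1 - t E_{ij}`:
`(T X T⁻¹)_{kl} = x_{kl} + t [k=i] x_{jl} - t [l=j] x_{ki} - t² [k=i][l=j] x_{ji}`. [folklore] -/
def conjVec (i j : Fin n) (t : K) (x : Fin n × Fin n → K) : Fin n × Fin n → K := fun p =>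
  x p + t * (if p.1 = i then x (j, p.2) else 0) - t * (if p.2 = j then x (p.1, i) else 0) -
    t ^ 2 * (if p.1 = i ∧ p.2 = j then x (j, i) else 0)

/-- `(transvection j i t)ᵀ = transvection i j t`. [folklore] -/
private theorem transpose_transvection (i j : Fin n) (t : K) :
    (Matrix.transvection j i t)ᵀ = Matrix.transvection i j t := by
  rw [Matrix.transvection, Matrix.transvection, Matrix.transpose_add, Matrix.transpose_one,
    Matrix.transpose_single]

/-- **The substitution `adSubst (transvection j i t) (transvection j i (-t))` acts on coefficient
vectors as conjugation by the transvection `T = 1 + t E_{ij}`**: `x ↦ T X T⁻¹`. [folklore] -/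
private theorem adSubst_transvection_mulVec {i j : Fin n} (t : K) (x : Fin n × Fin n → K) :
    (adSubst (Matrix.transvection j i t) (Matrix.transvection j i (-t))).mulVec x =
      conjVec i j t x := by
  funext ⟨k, l⟩
  rw [adSubst_mulVec, transpose_transvection, transpose_transvection]
  set X : Matrix (Fin n) (Fin n) K := Matrix.of fun a b => x (a, b) with hX
  have hX' : ∀ a b, X a b = x (a, b) := fun a b => rfl
  set T : Matrix (Fin n) (Fin n) K := Matrix.transvection i j t with hT
  -- left multiplication adds `t ×` row `j` to row `i`
  have hM : ∀ a b, (T * X) a b = x (a, b) + (if a = i then t * x (j, b) else 0) := by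
    intro a b
    by_cases ha : a = i
    · rw [ha, hT, Matrix.transvection_mul_apply_same, hX', hX', if_pos rfl]
    · rw [hT, Matrix.transvection_mul_apply_of_ne i j a b ha, hX', if_neg ha, add_zero]
  -- right multiplication adds `-t ×` column `i` to column `j`
  have hMT : (T * X * Matrix.transvection i j (-t)) k l =
      (T * X) k l + (if l = j then (-t) * (T * X) k i else 0) := by
    by_cases hl : l = j
    · rw [hl, Matrix.mul_transvection_apply_same, if_pos rfl]
    · rw [Matrix.mul_transvection_apply_of_ne i j k l hl, if_neg hl, add_zero]
  rw [hMT, hM, hM]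
  simp only [conjVec]
  by_cases hk : k = i <;> by_cases hl : l = j <;> simp [hk, hl] <;> ring

/-- The corresponding element of `SL_{n²}(K)`. [folklore] -/
private theorem det_adSubst_transvection {i j : Fin n} (hij : i ≠ j) (t : K) :
    (adSubst (Matrix.transvection j i t) (Matrix.transvection j i (-t))).det = 1 := by
  rw [det_adSubst, Matrix.det_transvection_of_ne j i (Ne.symm hij),
    Matrix.det_transvection_of_ne j i (Ne.symm hij), one_mul, one_pow]

/-- It fixes `trace(Y^m)`. [folklore] -/
private theorem linSubst_adSubst_transvection_tracePow {i j : Fin n} (hij : i ≠ j) (t : K) (m : ℕ) :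
    linSubst (Fin n × Fin n) K (adSubst (Matrix.transvection j i t) (Matrix.transvection j i (-t)))
      (tracePow K n m) = tracePow K n m := by
  apply linSubst_adSubst_tracePow
  rw [Matrix.transvection_mul_transvection_same j i (Ne.symm hij), neg_add_cancel,
    Matrix.transvection_zero]

/-- **Every subspace of `K^{n²}` stable under the `SL`-stabiliser of `trace(Y^m)` is stable under
conjugation by transvections.** [folklore] -/
private theorem conjVec_mem_of_stable {m : ℕ} {W : Submodule K (Fin n × Fin n → K)}
    (hW : ∀ γ : Matrix.SpecialLinearGroup (Fin n × Fin n) K,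
      linSubst (Fin n × Fin n) K (γ : Matrix (Fin n × Fin n) (Fin n × Fin n) K) (tracePow K n m) =
        tracePow K n m → ∀ x ∈ W, (γ : Matrix (Fin n × Fin n) (Fin n × Fin n) K).mulVec x ∈ W)
    {i j : Fin n} (hij : i ≠ j) (t : K) {x : Fin n × Fin n → K} (hx : x ∈ W) :
    conjVec i j t x ∈ W := by
  have h := hW ⟨adSubst (Matrix.transvection j i t) (Matrix.transvection j i (-t)),
    det_adSubst_transvection hij t⟩ (linSubst_adSubst_transvection_tracePow hij t m) x hx
  rwa [adSubst_transvection_mulVec] at h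

end Transvection

/-! ## §4. Subspaces of `M_n(K)` stable under conjugation by transvections: `0`, `K·1`, `sl_n`, `M_n` -/

section Classification

variable {K : Type} [Field K] {n : ℕ}

/-- The matrix unit `E_{kl}` as a coefficient vector. [folklore] -/
def vecE (k l : Fin n) : Fin n × Fin n → K := fun q => if q.1 = k ∧ q.2 = l then 1 else 0

/-- The identity matrix as a coefficient vector. [folklore] -/
def vecI : Fin n × Fin n → K := fun q => if q.1 = q.2 then 1 else 0

/-- The trace as a linear form on coefficient vectors. [folklore] -/
def trLin : (Fin n × Fin n → K) →ₗ[K] K := ∑ i : Fin n, LinearMap.proj ((i, i) : Fin n × Fin n)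

/-- `trLin x = ∑ x_{ii}`. [folklore] -/
private theorem trLin_apply (x : Fin n × Fin n → K) : trLin x = ∑ i, x (i, i) := by
  simp [trLin, LinearMap.sum_apply]

omit [Field K] in
/-- `vecE k l q = [q = (k,l)]`. [folklore] -/
private theorem vecE_apply [Field K] (k l : Fin n) (q : Fin n × Fin n) :
    (vecE k l : Fin n × Fin n → K) q = if q.1 = k ∧ q.2 = l then 1 else 0 := rfl

/-- The first-order term `E_{ij} X - X E_{ij}` of the conjugation. [folklore] -/
private def dOne (i j : Fin n) (x : Fin n × Fin n → K) : Fin n × Fin n → K := fun p =>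
  (if p.1 = i then x (j, p.2) else 0) - (if p.2 = j then x (p.1, i) else 0)

/-- The second-order term `E_{ij} X E_{ij} = x_{ji} E_{ij}`. [folklore] -/
private def dTwo (i j : Fin n) (x : Fin n × Fin n → K) : Fin n × Fin n → K := fun p =>
  if p.1 = i ∧ p.2 = j then x (j, i) else 0

/-- `T X T⁻¹ = X + t (E X - X E) - t² (E X E)`. [folklore] -/
private theorem conjVec_eq (i j : Fin n) (t : K) (x : Fin n × Fin n → K) :
    conjVec i j t x = x + t • dOne i j x - t ^ 2 • dTwo i j x := by
  funext p
  simp only [conjVec, dOne, dTwo, Pi.add_apply, Pi.sub_apply, Pi.smul_apply, smul_eq_mul]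
  ring

variable {W : Submodule K (Fin n × Fin n → K)}

/-- **Polarisation**: a subspace stable under all `T X T⁻¹` (three values of `t` suffice, `K`
infinite) contains both Taylor terms. [folklore] -/
private theorem dTwo_mem_and_dOne_mem [Infinite K]
    (hW : ∀ i j : Fin n, i ≠ j → ∀ (t : K), ∀ x ∈ W, conjVec i j t x ∈ W)
    {i j : Fin n} (hij : i ≠ j) {x : Fin n × Fin n → K} (hx : x ∈ W) :
    dTwo i j x ∈ W ∧ dOne i j x ∈ W := by
  classical
  obtain ⟨t₀, ht₀⟩ := Infinite.exists_notMem_finset ({0, 1} : Finset K)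
  simp only [Finset.mem_insert, Finset.mem_singleton, not_or] at ht₀
  have w1 := hW i j hij 1 x hx
  have w2 := hW i j hij t₀ x hx
  rw [conjVec_eq] at w1 w2
  have e1 : dOne i j x - dTwo i j x ∈ W := by
    have h' := W.sub_mem w1 hx
    have : x + (1 : K) • dOne i j x - (1 : K) ^ 2 • dTwo i j x - x = dOne i j x - dTwo i j x := by
      simp only [one_smul, one_pow]; abel
    rwa [this] at h'
  have e2 : t₀ • dOne i j x - t₀ ^ 2 • dTwo i j x ∈ W := by
    have h' := W.sub_mem w2 hx
    have : x + t₀ • dOne i j x - t₀ ^ 2 • dTwo i j x - x = t₀ • dOne i j x - t₀ ^ 2 • dTwo i j x := by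
      abel
    rwa [this] at h'
  have e3 : (t₀ ^ 2 - t₀) • dTwo i j x ∈ W := by
    have h3 := W.sub_mem (W.smul_mem t₀ e1) e2
    have : t₀ • (dOne i j x - dTwo i j x) - (t₀ • dOne i j x - t₀ ^ 2 • dTwo i j x) =
        (t₀ ^ 2 - t₀) • dTwo i j x := by
      rw [smul_sub, sub_smul]; abel
    rwa [this] at h3
  have ht : t₀ ^ 2 - t₀ ≠ 0 := by
    have : t₀ ^ 2 - t₀ = t₀ * (t₀ - 1) := by ring
    rw [this]
    exact mul_ne_zero ht₀.1 (sub_ne_zero.mpr ht₀.2)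
  have hD2 : dTwo i j x ∈ W := (W.smul_mem_iff ht).mp e3
  refine ⟨hD2, ?_⟩
  have := W.add_mem e1 hD2
  rwa [sub_add_cancel] at this

/-- Spread (i): `E_{ij} ∈ W ⇒ E_{ji} ∈ W` (the second-order term of `T_{ji}`). [folklore] -/
private theorem vecE_swap_mem [Infinite K]
    (hW : ∀ i j : Fin n, i ≠ j → ∀ (t : K), ∀ x ∈ W, conjVec i j t x ∈ W)
    {i j : Fin n} (hij : i ≠ j) (h : (vecE i j : Fin n × Fin n → K) ∈ W) :
    (vecE j i : Fin n × Fin n → K) ∈ W := by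
  have h2 := (dTwo_mem_and_dOne_mem hW (Ne.symm hij) h).1
  have : dTwo j i (vecE i j : Fin n × Fin n → K) = vecE j i := by
    funext ⟨a, b⟩
    simp only [dTwo, vecE_apply]
    by_cases ha : a = j <;> by_cases hb : b = i <;> simp [ha, hb]
  rwa [this] at h2

/-- Spread (ii): `E_{ij} ∈ W`, `k ∉ {i, j}` ⇒ `E_{kj} ∈ W` (first-order term of `T_{ki}`).
[folklore] -/
private theorem vecE_row_mem [Infinite K]
    (hW : ∀ i j : Fin n, i ≠ j → ∀ (t : K), ∀ x ∈ W, conjVec i j t x ∈ W)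
    {i j k : Fin n} (hki : k ≠ i) (hkj : k ≠ j) (h : (vecE i j : Fin n × Fin n → K) ∈ W) :
    (vecE k j : Fin n × Fin n → K) ∈ W := by
  have h1 := (dTwo_mem_and_dOne_mem hW hki h).2
  have : dOne k i (vecE i j : Fin n × Fin n → K) = vecE k j := by
    funext ⟨a, b⟩
    simp only [dOne, vecE_apply]
    by_cases ha : a = k <;> by_cases hb : b = j <;> by_cases hb' : b = i <;>
      by_cases ha' : a = i <;> simp [ha, hb, hb', ha', hkj, hki, Ne.symm hki]
  rwa [this] at h1

/-- Spread (iii): `E_{ij} ∈ W`, `l ∉ {i, j}` ⇒ `E_{il} ∈ W` (first-order term of `T_{jl}`).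
[folklore] -/
private theorem vecE_col_mem [Infinite K]
    (hW : ∀ i j : Fin n, i ≠ j → ∀ (t : K), ∀ x ∈ W, conjVec i j t x ∈ W)
    {i j l : Fin n} (hli : l ≠ i) (hlj : l ≠ j) (h : (vecE i j : Fin n × Fin n → K) ∈ W) :
    (vecE i l : Fin n × Fin n → K) ∈ W := by
  have h1 := (dTwo_mem_and_dOne_mem hW (Ne.symm hlj) h).2
  have : dOne j l (vecE i j : Fin n × Fin n → K) = -vecE i l := by
    funext ⟨a, b⟩
    simp only [dOne, vecE_apply, Pi.neg_apply]
    by_cases ha : a = i <;> by_cases hb : b = l <;> by_cases ha' : a = j <;>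
      by_cases hb' : b = j <;> simp [ha, hb, ha', hb', hli, hlj, Ne.symm hlj]
  rw [this] at h1
  exact (W.neg_mem_iff).mp h1

/-- Spread: one off-diagonal unit `E_{ij} ∈ W` gives all of them. [folklore] -/
private theorem forall_vecE_mem [Infinite K]
    (hW : ∀ i j : Fin n, i ≠ j → ∀ (t : K), ∀ x ∈ W, conjVec i j t x ∈ W)
    {i j : Fin n} (hij : i ≠ j) (h : (vecE i j : Fin n × Fin n → K) ∈ W) :
    ∀ k l : Fin n, k ≠ l → (vecE k l : Fin n × Fin n → K) ∈ W := by
  -- step A: the whole column `j`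
  have hA : ∀ k, k ≠ j → (vecE k j : Fin n × Fin n → K) ∈ W := by
    intro k hkj
    by_cases hki : k = i
    · subst hki; exact h
    · exact vecE_row_mem hW hki hkj h
  -- step B: rows of the column
  have hB : ∀ k l, k ≠ j → k ≠ l → (vecE k l : Fin n × Fin n → K) ∈ W := by
    intro k l hkj hkl
    by_cases hlj : l = j
    · subst hlj; exact hA k hkj
    · exact vecE_col_mem hW (Ne.symm hkl) hlj (hA k hkj)
  intro k l hkl
  by_cases hkj : k = j
  · subst hkj
    exact vecE_swap_mem hW (Ne.symm hkl) (hA l (Ne.symm hkl))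
  · exact hB k l hkj hkl

/-- Diagonal differences: `E_{lk} ∈ W ⇒ E_{kk} - E_{ll} ∈ W` (first-order term of `T_{kl}`).
[folklore] -/
private theorem vecE_diag_sub_mem [Infinite K]
    (hW : ∀ i j : Fin n, i ≠ j → ∀ (t : K), ∀ x ∈ W, conjVec i j t x ∈ W)
    {k l : Fin n} (hkl : k ≠ l) (h : (vecE l k : Fin n × Fin n → K) ∈ W) :
    (vecE k k : Fin n × Fin n → K) - vecE l l ∈ W := by
  have h1 := (dTwo_mem_and_dOne_mem hW hkl h).2
  have : dOne k l (vecE l k : Fin n × Fin n → K) = vecE k k - vecE l l := by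
    funext ⟨a, b⟩
    simp only [dOne, vecE_apply, Pi.sub_apply]
    by_cases ha : a = k <;> by_cases hb : b = l <;> by_cases ha' : a = l <;>
      by_cases hb' : b = k <;> simp [ha, hb, ha', hb', hkl, Ne.symm hkl]
  rwa [this] at h1

/-- If `W` contains all off-diagonal units and all `E_{kk} - E_{00}` then `sl_n ≤ W`. [folklore] -/
private theorem ker_trLin_le [NeZero n]
    (hoff : ∀ k l : Fin n, k ≠ l → (vecE k l : Fin n × Fin n → K) ∈ W)
    (hdiag : ∀ k : Fin n, (vecE k k : Fin n × Fin n → K) - vecE 0 0 ∈ W) :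
    LinearMap.ker (trLin (K := K) (n := n)) ≤ W := by
  classical
  intro x hx
  rw [LinearMap.mem_ker, trLin_apply] at hx
  -- off-diagonal part and diagonal part
  set y : Fin n × Fin n → K :=
    ∑ p : Fin n × Fin n, (if p.1 = p.2 then 0 else x p) • (vecE p.1 p.2 : Fin n × Fin n → K) with hy
  set z : Fin n × Fin n → K :=
    ∑ k : Fin n, x (k, k) • ((vecE k k : Fin n × Fin n → K) - vecE 0 0) with hz
  have hyW : y ∈ W := by
    refine W.sum_mem fun p _ => ?_
    by_cases hp : p.1 = p.2
    · rw [if_pos hp, zero_smul]; exact W.zero_mem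
    · rw [if_neg hp]; exact W.smul_mem _ (hoff _ _ hp)
  have hzW : z ∈ W := W.sum_mem fun k _ => W.smul_mem _ (hdiag k)
  have hxyz : x = y + z := by
    funext ⟨a, b⟩
    simp only [hy, hz, Pi.add_apply, Finset.sum_apply, Pi.smul_apply, Pi.sub_apply, smul_eq_mul,
      vecE_apply, mul_ite, mul_one, mul_zero, mul_sub]
    rw [Fintype.sum_prod_type]
    by_cases hab : a = b
    · subst hab
      -- off-diagonal part vanishes at `(a,a)`; diagonal part gives `x (a,a) - [a = 0] ∑ x(k,k)`
      have h1 : ∑ k : Fin n, ∑ l : Fin n,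
          (if a = k ∧ a = l then (if k = l then (0 : K) else x (k, l)) else 0) = 0 := by
        refine Finset.sum_eq_zero fun k _ => Finset.sum_eq_zero fun l _ => ?_
        by_cases h : a = k ∧ a = l
        · rw [if_pos h, if_pos (h.1.symm.trans h.2)]
        · rw [if_neg h]
      have h2 : ∑ k : Fin n, ((if a = k ∧ a = k then x (k, k) else 0) -
          (if a = (0 : Fin n) ∧ a = (0 : Fin n) then x (k, k) else 0)) = x (a, a) := by
        rw [Finset.sum_sub_distrib]
        have : ∑ k : Fin n, (if a = k ∧ a = k then x (k, k) else 0) = x (a, a) := by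
          simp only [and_self, Finset.sum_ite_eq, Finset.mem_univ, if_true]
        rw [this]
        by_cases h0 : a = (0 : Fin n)
        · simp only [h0, and_self, if_true, hx, sub_zero]
        · simp [h0]
      rw [h1, h2, zero_add]
    · have h1 : ∑ k : Fin n, ∑ l : Fin n,
          (if a = k ∧ b = l then (if k = l then (0 : K) else x (k, l)) else 0) = x (a, b) := by
        rw [Finset.sum_eq_single a, Finset.sum_eq_single b]
        · simp [hab]
        · intro l _ hl; rw [if_neg]; exact fun h => hl h.2.symm
        · simp
        · intro k _ hk; exact Finset.sum_eq_zero fun l _ => by rw [if_neg]; exact fun h => hk h.1.symm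
        · simp
      have h2 : ∑ k : Fin n, ((if a = k ∧ b = k then x (k, k) else 0) -
          (if a = (0 : Fin n) ∧ b = (0 : Fin n) then x (k, k) else 0)) = 0 := by
        refine Finset.sum_eq_zero fun k _ => ?_
        rw [if_neg, if_neg, sub_zero]
        · rintro ⟨rfl, rfl⟩; exact hab rfl
        · rintro ⟨rfl, rfl⟩; exact hab rfl
      rw [h1, h2, add_zero]
  rw [hxyz]
  exact W.add_mem hyW hzW

/-- `sl_n ≤ W ⇒ W = sl_n ∨ W = M_n` (a hyperplane is maximal). [folklore] -/
private theorem eq_ker_or_eq_top_of_ker_le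
    (h : LinearMap.ker (trLin (K := K) (n := n)) ≤ W) :
    W = LinearMap.ker (trLin (K := K) (n := n)) ∨ W = ⊤ := by
  by_cases hW : W ≤ LinearMap.ker (trLin (K := K) (n := n))
  · exact Or.inl (le_antisymm hW h)
  · right
    obtain ⟨w, hwW, hwk⟩ := Set.not_subset.mp hW
    rw [SetLike.mem_coe, LinearMap.mem_ker] at hwk
    rw [eq_top_iff]
    intro x _
    have hsplit : x = (x - (trLin x / trLin w) • w) + (trLin x / trLin w) • w := by
      rw [sub_add_cancel]
    rw [hsplit]
    refine W.add_mem (h ?_) (W.smul_mem _ hwW)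
    rw [LinearMap.mem_ker, map_sub, map_smul, smul_eq_mul, div_mul_cancel₀ _ hwk, sub_self]

/-- If every element of `W` is diagonal then `W ≤ K · 1`. [folklore] -/
private theorem le_span_vecI_of_offDiag_eq_zero [Infinite K] [NeZero n]
    (hW : ∀ i j : Fin n, i ≠ j → ∀ (t : K), ∀ x ∈ W, conjVec i j t x ∈ W)
    (hoff : ∀ x ∈ W, ∀ k l : Fin n, k ≠ l → x (k, l) = 0) :
    W ≤ K ∙ (vecI : Fin n × Fin n → K) := by
  intro x hx
  have hdiag : ∀ i j : Fin n, i ≠ j → x (i, i) = x (j, j) := by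
    intro i j hij
    have h1 := (dTwo_mem_and_dOne_mem hW hij hx).2
    have h2 := hoff _ h1 i j hij
    simp only [dOne, if_true] at h2
    exact (sub_eq_zero.mp h2).symm
  rw [Submodule.mem_span_singleton]
  refine ⟨x (0, 0), ?_⟩
  funext ⟨a, b⟩
  simp only [Pi.smul_apply, vecI, smul_eq_mul, mul_ite, mul_one, mul_zero]
  by_cases hab : a = b
  · subst hab
    rw [if_pos rfl]
    by_cases h0 : (0 : Fin n) = a
    · rw [h0]
    · exact hdiag 0 a h0
  · rw [if_neg hab]
    exact (hoff x hx a b hab).symm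

omit [Field K] in
/-- A subspace of a line is `0` or the line. [folklore] -/
private theorem eq_bot_or_eq_span_of_le_span [Field K] {V : Type*} [AddCommGroup V] [Module K V]
    {U : Submodule K V} {v : V} (hU : U ≤ K ∙ v) : U = ⊥ ∨ U = K ∙ v := by
  by_cases hb : U = ⊥
  · exact Or.inl hb
  · right
    refine le_antisymm hU ?_
    obtain ⟨w, hwU, hw0⟩ := (Submodule.ne_bot_iff U).mp hb
    obtain ⟨c, rfl⟩ := Submodule.mem_span_singleton.mp (hU hwU)
    have hc : c ≠ 0 := by
      rintro rfl
      exact hw0 (zero_smul K v)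
    rw [Submodule.span_singleton_le_iff_mem]
    have := U.smul_mem c⁻¹ hwU
    rwa [smul_smul, inv_mul_cancel₀ hc, one_smul] at this

/-- **Subspaces of `M_n(K)` stable under conjugation by all transvections are `0`, `K · 1`,
`sl_n`, or `M_n`** (`K` infinite, `n ≥ 1`): the adjoint representation of `SL_n` on `sl_n`
argument, written with elementary matrices. [folklore] -/
private theorem submodule_eq_of_conjVec_mem [Infinite K] [NeZero n] (W : Submodule K (Fin n × Fin n → K))
    (hW : ∀ i j : Fin n, i ≠ j → ∀ (t : K), ∀ x ∈ W, conjVec i j t x ∈ W) :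
    W = ⊥ ∨ W = K ∙ (vecI : Fin n × Fin n → K) ∨
      W = LinearMap.ker (trLin (K := K) (n := n)) ∨ W = ⊤ := by
  classical
  by_cases hoff : ∀ x ∈ W, ∀ k l : Fin n, k ≠ l → x (k, l) = 0
  · rcases eq_bot_or_eq_span_of_le_span (le_span_vecI_of_offDiag_eq_zero hW hoff) with h | h
    · exact Or.inl h
    · exact Or.inr (Or.inl h)
  · push Not at hoff
    obtain ⟨x, hx, k, l, hkl, hxkl⟩ := hoff
    -- `x_{kl} E_{lk} ∈ W`, hence `E_{lk} ∈ W`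
    have h2 := (dTwo_mem_and_dOne_mem hW (Ne.symm hkl) hx).1
    have hE : dTwo l k x = x (k, l) • (vecE l k : Fin n × Fin n → K) := by
      funext ⟨a, b⟩
      simp only [dTwo, Pi.smul_apply, vecE_apply, smul_eq_mul, mul_ite, mul_one, mul_zero]
    rw [hE] at h2
    have hlk : (vecE l k : Fin n × Fin n → K) ∈ W := (W.smul_mem_iff hxkl).mp h2
    have hall := forall_vecE_mem hW (Ne.symm hkl) hlk
    have hdiag : ∀ k : Fin n, (vecE k k : Fin n × Fin n → K) - vecE 0 0 ∈ W := by
      intro k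
      by_cases hk0 : k = 0
      · subst hk0; rw [sub_self]; exact W.zero_mem
      · exact vecE_diag_sub_mem hW hk0 (hall 0 k (Ne.symm hk0))
    exact Or.inr (Or.inr (eq_ker_or_eq_top_of_ker_le (ker_trLin_le hall hdiag)))

end Classification

/-! ## §5. `trace(Y^n)` vanishes on no hyperplane of `M_n` (`n ≥ 2`, `n ≠ 0` in `K`) -/

section NoHyperplane

variable {K : Type} [Field K] {n : ℕ}

/-- An idempotent matrix equals all its positive powers. [folklore] -/
private theorem pow_succ_eq_self_of_mul_self {Y : Matrix (Fin n) (Fin n) K} (h : Y * Y = Y) :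
    ∀ k : ℕ, Y ^ (k + 1) = Y
  | 0 => pow_one Y
  | k + 1 => by rw [pow_succ, pow_succ_eq_self_of_mul_self h k, h]

/-- `Y² = Y ⇒ Y^k = Y` for `k ≥ 1`. [folklore] -/
private theorem pow_eq_self_of_mul_self {Y : Matrix (Fin n) (Fin n) K} (h : Y * Y = Y) {k : ℕ}
    (hk : 1 ≤ k) : Y ^ k = Y := by
  obtain ⟨m, rfl⟩ := Nat.exists_eq_add_of_le' hk
  exact pow_succ_eq_self_of_mul_self h m

/-- The pairing `⟨b, Y⟩ = ∑ b_p Y_p` against a matrix unit. [folklore] -/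
private theorem sum_mul_single (b : Fin n × Fin n → K) (k l : Fin n) (c : K) :
    ∑ p : Fin n × Fin n, b p * Matrix.single k l c p.1 p.2 = b (k, l) * c := by
  rw [Finset.sum_eq_single (k, l)]
  · rw [Matrix.single_apply_same]
  · rintro ⟨a, d⟩ _ hne
    rw [Matrix.single_apply_of_ne, mul_zero]
    rintro ⟨rfl, rfl⟩
    exact hne rfl
  · intro h; exact absurd (Finset.mem_univ _) h

/-- The cyclic shift `S_{i,i+1} = 1`. [folklore] -/
def shiftMat (n : ℕ) [NeZero n] (K : Type) [Field K] : Matrix (Fin n) (Fin n) K :=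
  Matrix.of fun i j => if j = i + 1 then 1 else 0

/-- Powers of the shift: `(S^l)_{ij} = [j = i + l]`. [folklore] -/
private theorem shiftMat_pow_apply [NeZero n] (l : ℕ) (i j : Fin n) :
    (shiftMat n K ^ l) i j = if j = i + l • (1 : Fin n) then 1 else 0 := by
  induction l generalizing i j with
  | zero =>
    rw [pow_zero, Matrix.one_apply, zero_nsmul, add_zero]
    simp only [eq_comm]
  | succ l ih =>
    rw [pow_succ, Matrix.mul_apply, Finset.sum_eq_single (i + l • (1 : Fin n))]
    · rw [ih, if_pos rfl, shiftMat, Matrix.of_apply, one_mul, succ_nsmul, ← add_assoc]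
    · intro t _ ht
      rw [ih, if_neg ht, zero_mul]
    · intro h
      exact absurd (Finset.mem_univ _) h

open Fin.NatCast in
/-- `trace(S^n) = n`. [folklore] -/
private theorem trace_shiftMat_pow_self [NeZero n] : (shiftMat n K ^ n).trace = n := by
  simp only [Matrix.trace, Matrix.diag, shiftMat_pow_apply, nsmul_one, Fin.natCast_self,
    add_zero, if_true, Finset.sum_const, Finset.card_univ, Fintype.card_fin, nsmul_eq_mul, mul_one]

/-- **`trace(Y^n)` vanishes on no hyperplane of `M_n(K)`** (`n ≥ 2`, `(n : K) ≠ 0`): for every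
coefficient vector `b` there is a matrix `Y` with `∑_p b_p Y_p = 0` and `trace(Y^n) ≠ 0` — a rank-one
idempotent (trace `1`) in the hyperplane, or, when the hyperplane is `sl_n`, the cyclic shift
(`trace(S^n) = n`). [folklore] -/
private theorem exists_trace_pow_ne_zero (hn : 2 ≤ n) (hchar : (n : K) ≠ 0) (b : Fin n × Fin n → K) :
    ∃ Y : Matrix (Fin n) (Fin n) K, (∑ p : Fin n × Fin n, b p * Y p.1 p.2) = 0 ∧
      (Y ^ n).trace ≠ 0 := by
  classical
  haveI : NeZero n := ⟨by omega⟩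
  -- an idempotent of trace one in the hyperplane suffices
  have key : ∀ Y : Matrix (Fin n) (Fin n) K, Y * Y = Y → Y.trace = 1 →
      (∑ p : Fin n × Fin n, b p * Y p.1 p.2) = 0 →
      ∃ Y : Matrix (Fin n) (Fin n) K, (∑ p : Fin n × Fin n, b p * Y p.1 p.2) = 0 ∧
        (Y ^ n).trace ≠ 0 := by
    intro Y hY htr hb
    refine ⟨Y, hb, ?_⟩
    rw [pow_eq_self_of_mul_self hY (by omega : 1 ≤ n), htr]
    exact one_ne_zero
  by_cases hoff : ∃ k l : Fin n, k ≠ l ∧ b (k, l) ≠ 0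
  · -- (i) an off-diagonal coefficient: `Y = E_{ll} - (b_{ll}/b_{kl}) E_{kl}`
    obtain ⟨k, l, hkl, hbkl⟩ := hoff
    set c : K := -(b (l, l) / b (k, l)) with hc
    have h1 : Matrix.single l l (1 : K) * Matrix.single k l c = 0 :=
      Matrix.single_mul_single_of_ne 1 l l k (Ne.symm hkl) c
    have h2 : Matrix.single k l c * Matrix.single k l c = 0 :=
      Matrix.single_mul_single_of_ne c k l k (Ne.symm hkl) c
    refine key (Matrix.single l l 1 + Matrix.single k l c) ?_ ?_ ?_
    · rw [add_mul, mul_add, mul_add, Matrix.single_mul_single_same, h1, Matrix.single_mul_single_same,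
        h2, mul_one, mul_one, add_zero, add_zero]
    · simp only [Matrix.trace, Matrix.diag, Matrix.add_apply, Matrix.single_apply, and_self,
        Finset.sum_add_distrib, Finset.sum_ite_eq, Finset.mem_univ, if_true]
      rw [Finset.sum_eq_zero, add_zero]
      intro i _
      rw [if_neg]
      rintro ⟨rfl, rfl⟩
      exact hkl rfl
    · simp only [Matrix.add_apply, mul_add, Finset.sum_add_distrib, sum_mul_single]
      rw [hc, mul_one]
      field_simp
      ring
  · push Not at hoff
    -- from here on `b` is supported on the diagonal
    have hpair : ∀ Y : Matrix (Fin n) (Fin n) K,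
        (∑ p : Fin n × Fin n, b p * Y p.1 p.2) = ∑ a : Fin n, b (a, a) * Y a a := by
      intro Y
      rw [Fintype.sum_prod_type]
      refine Finset.sum_congr rfl fun a _ => ?_
      rw [Finset.sum_eq_single a]
      · intro d _ hd
        rw [hoff a d (Ne.symm hd), zero_mul]
      · intro h; exact absurd (Finset.mem_univ _) h
    by_cases hne : ∃ k l : Fin n, b (k, k) ≠ b (l, l)
    · -- (ii) two distinct diagonal coefficients: the rank-one idempotent `p qᵀ`,
      -- `p = e_k + e_l`, `q = c e_k + (1 - c) e_l`, `c = b_{ll} / (b_{ll} - b_{kk})`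
      obtain ⟨k, l, hbkl⟩ := hne
      have hkl : k ≠ l := by rintro rfl; exact hbkl rfl
      set c : K := b (l, l) / (b (l, l) - b (k, k)) with hc
      set p : Fin n → K := Pi.single k 1 + Pi.single l 1 with hp
      set q : Fin n → K := Pi.single k c + Pi.single l (1 - c) with hq
      have hpq_apply : ∀ a, p a * q a = (if a = k then c else 0) + (if a = l then 1 - c else 0) := by
        intro a
        by_cases hak : a = k
        · subst hak
          simp [hp, hq, hkl]
        · by_cases hal : a = l
          · subst hal
            simp [hp, hq, hak]
          · simp [hp, hq, hak, hal]
      have hqp : q ⬝ᵥ p = 1 := by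
        rw [dotProduct]
        simp_rw [mul_comm (q _) (p _), hpq_apply]
        rw [Finset.sum_add_distrib, Finset.sum_ite_eq', Finset.sum_ite_eq']
        simp
      have hpq : p ⬝ᵥ q = 1 := by rw [dotProduct_comm]; exact hqp
      refine key (Matrix.vecMulVec p q) ?_ ?_ ?_
      · rw [Matrix.vecMulVec_mul_vecMulVec, hqp, one_smul]
      · rw [Matrix.trace_vecMulVec, hpq]
      · rw [hpair]
        simp_rw [Matrix.vecMulVec_apply, hpq_apply, mul_add, Finset.sum_add_distrib, mul_ite,
          mul_zero, Finset.sum_ite_eq', Finset.mem_univ, if_true]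
        have hsub : b (l, l) - b (k, k) ≠ 0 := sub_ne_zero.mpr (Ne.symm hbkl)
        rw [hc]
        field_simp
        ring
    · -- (iii) `b = b₀ · 1`: the hyperplane is `sl_n` (or everything); take the cyclic shift
      push Not at hne
      have h10 : (1 : Fin n) ≠ 0 := by
        intro h
        have h' := congrArg Fin.val h
        rw [Fin.val_one', Fin.val_zero, Nat.mod_eq_of_lt (by omega)] at h'
        exact one_ne_zero h'
      refine ⟨shiftMat n K, ?_, ?_⟩
      · rw [hpair]
        refine Finset.sum_eq_zero fun a _ => ?_
        simp only [shiftMat, Matrix.of_apply]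
        rw [if_neg, mul_zero]
        intro h
        apply h10
        have h' : a + 1 = a + 0 := by rw [add_zero]; exact h.symm
        exact add_left_cancel h'
      · rw [trace_shiftMat_pow_self]; exact hchar

end NoHyperplane

/-! ## §6. Evaluation bookkeeping for the substituted form `h · v` -/

section EvalLemmas

variable {K : Type} [Field K] {σ : Type} [Fintype σ] [DecidableEq σ]

omit [DecidableEq σ] in
/-- `(A · f)(x) = f(x A)`: evaluating a linear substitution. [folklore] -/
private theorem eval_linSubst (A : Matrix σ σ K) (x : σ → K) (f : MvPolynomial σ K) :
    eval x (linSubst σ K A f) = eval (Matrix.vecMul x A) f := by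
  have h1 : linSubst σ K A f = bind₁ (fun i => ∑ j, A j i • (X j : MvPolynomial σ K)) f := rfl
  have hfun : (fun i => eval x (∑ j, A j i • (X j : MvPolynomial σ K))) = Matrix.vecMul x A := by
    funext i
    rw [Matrix.vecMul, dotProduct, map_sum]
    exact Finset.sum_congr rfl fun j _ => by rw [smul_eval, eval_X, mul_comm]
  rw [h1, ← hfun, eval, eval₂Hom_bind₁]
  rfl

omit [DecidableEq σ] in
/-- Monomials of a form of degree `D` have total degree `D`. [folklore] -/
private theorem sum_eq_of_mem_support {u : MvPolynomial σ K} {D : ℕ} (hu : u.IsHomogeneous D)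
    {d : σ →₀ ℕ} (hd : d ∈ u.support) : ∑ i, d i = D := by
  have hdeg : d.degree = D := by
    rw [Finsupp.degree_eq_weight_one]
    exact hu (mem_support_iff.mp hd)
  rwa [Finsupp.degree_eq_sum] at hdeg

omit [Fintype σ] [DecidableEq σ] in
/-- If every monomial of `u` involves the variable `i₀` then `u` vanishes where `x_{i₀} = 0`.
[folklore] -/
private theorem eval_eq_zero_of_forall_mem_support {u : MvPolynomial σ K} {i₀ : σ}
    (h : ∀ d ∈ u.support, d i₀ ≠ 0) {x : σ → K} (hx : x i₀ = 0) : eval x u = 0 := by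
  rw [eval_eq]
  refine Finset.sum_eq_zero fun d hd => ?_
  rw [Finset.prod_eq_zero (Finsupp.mem_support_iff.mpr (h d hd)), mul_zero]
  rw [hx, zero_pow (h d hd)]

/-- If no monomial of a form `u` of positive degree involves `i₁` then `u` vanishes on the axis
`K e_{i₁}`. [folklore] -/
private theorem eval_single_eq_zero_of_forall_mem_support {u : MvPolynomial σ K} {D : ℕ}
    (hu : u.IsHomogeneous D) (hD : 0 < D) {i₁ : σ} (h : ∀ d ∈ u.support, d i₁ = 0) (c : K) :
    eval (Pi.single i₁ c) u = 0 := by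
  rw [eval_eq]
  refine Finset.sum_eq_zero fun d hd => ?_
  -- some variable `i ≠ i₁` occurs in `d`
  have hdeg := sum_eq_of_mem_support hu hd
  obtain ⟨i, hi⟩ : ∃ i, d i ≠ 0 := by
    by_contra hall
    push Not at hall
    rw [Finset.sum_eq_zero fun i _ => hall i] at hdeg
    omega
  have hii : i ≠ i₁ := fun e => hi (e ▸ h d hd)
  rw [Finset.prod_eq_zero (Finsupp.mem_support_iff.mpr hi), mul_zero]
  rw [Pi.single_eq_of_ne hii, zero_pow hi]

/-- `(M (vecE k l))_i = M_{i,(k,l)}`. [folklore] -/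
private theorem mulVec_vecE {n : ℕ} (M : Matrix (Fin n × Fin n) (Fin n × Fin n) K) (k l : Fin n)
    (i : Fin n × Fin n) : M.mulVec (vecE k l) i = M i (k, l) := by
  rw [Matrix.mulVec, dotProduct, Finset.sum_eq_single (k, l)]
  · rw [vecE_apply, if_pos ⟨rfl, rfl⟩, mul_one]
  · rintro ⟨a, b⟩ _ hne
    rw [vecE_apply, if_neg, mul_zero]
    rintro ⟨rfl, rfl⟩
    exact hne rfl
  · intro hh; exact absurd (Finset.mem_univ _) hh

end EvalLemmas

/-! ## §7. The flag of an admissible optimal pair for `trace(Y^n)` is impossible -/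

section Main

variable {K : Type} [Field K] {n : ℕ}

/-- `trace vecI = n`, `vecI ∉ sl_n` when `n ≠ 0` in `K`. [folklore] -/
private theorem trLin_vecI : trLin (vecI : Fin n × Fin n → K) = n := by
  rw [trLin_apply]
  simp [vecI]

/-- `E_{kl} ∈ sl_n` for `k ≠ l`. [folklore] -/
private theorem vecE_mem_ker {k l : Fin n} (hkl : k ≠ l) :
    (vecE k l : Fin n × Fin n → K) ∈ LinearMap.ker (trLin (K := K) (n := n)) := by
  rw [LinearMap.mem_ker, trLin_apply]
  refine Finset.sum_eq_zero fun i _ => ?_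
  rw [vecE_apply, if_neg]
  rintro ⟨rfl, rfl⟩
  exact hkl rfl

/-- `trace E_{kk} = 1`. [folklore] -/
private theorem trLin_vecE_same (k : Fin n) : trLin (vecE k k : Fin n × Fin n → K) = 1 := by
  rw [trLin_apply, Finset.sum_eq_single k]
  · rw [vecE_apply, if_pos ⟨rfl, rfl⟩]
  · intro i _ hi
    rw [vecE_apply, if_neg]
    exact fun h => hi h.1
  · intro h; exact absurd (Finset.mem_univ _) h

/-- `E_{kk} - E_{00} ∈ sl_n`. [folklore] -/
private theorem vecE_sub_mem_ker [NeZero n] (k : Fin n) :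
    (vecE k k : Fin n × Fin n → K) - vecE 0 0 ∈ LinearMap.ker (trLin (K := K) (n := n)) := by
  rw [LinearMap.mem_ker, map_sub, trLin_vecE_same, trLin_vecE_same, sub_self]

/-- A row of an invertible matrix that kills `sl_n` is a non-zero multiple of `vecI`.
[folklore] -/
private theorem row_eq_smul_vecI_of_ker_le [NeZero n] {h : Matrix (Fin n × Fin n) (Fin n × Fin n) K}
    {i : Fin n × Fin n}
    (hrow : ∀ x ∈ LinearMap.ker (trLin (K := K) (n := n)), h.mulVec x i = 0) :
    h i = h i (0, 0) • (vecI : Fin n × Fin n → K) := by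
  funext ⟨a, b⟩
  simp only [Pi.smul_apply, vecI, smul_eq_mul, mul_ite, mul_one, mul_zero]
  by_cases hab : a = b
  · subst hab
    rw [if_pos rfl]
    have := hrow _ (vecE_sub_mem_ker (K := K) a)
    rwa [Matrix.mulVec_sub, Pi.sub_apply, mulVec_vecE, mulVec_vecE, sub_eq_zero] at this
  · rw [if_neg hab]
    have := hrow _ (vecE_mem_ker (K := K) hab)
    rwa [mulVec_vecE] at this

/-- **GCT I §4.1 Remark, the Thm. 4.6 analogue: `trace(Y^m)` is stable.** For every
algebraically closed field `K` and every `m ≥ 2` with `(m : K) ≠ 0`, the form `tracePow K m m =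
trace(Y^m)` (degree `m` in the `m²` entries of `Y`) is polystable: its `SL_{m²}(K)`-orbit is
Zariski closed (MS's "stable", §3.1 AV p.7; the tree's `IsPolystable`), exactly as Thm. 4.6 asserts
for `det(Y)`. Printed: "the analogues of Proposition 4.1 and Theorem 4.6 hold for `trace(Y^m)` as
well" (no proof; §4 is over an algebraically closed field of arbitrary characteristic). The
hypothesis `(m : K) ≠ 0` is NECESSARY: for `m = char K` the form is `(∑ y_{ii})^m` and is not even
semistable (`MS2001_rem_4_1_trace_thm_4_6_analogue_false_charP`). Proof: Kempf's criterion as for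
Thm. 4.6 (`exists_isAdm_forall_weightFlag_stable_of_not_isPolystable`), the conjugation-invariant
subspaces of `M_m` (`submodule_eq_of_conjVec_mem`), and the two admissibility computations of the
module docstring. [cite: MulmuleySohoniSIAM2001, §4.1 Remark (AV p.16, all.txt L1122–1124) and Thm. 4.6 (AV p.15)]
[cite: Kempf1978, Cor. 4.4] -/
theorem isPolystable_tracePow [IsAlgClosed K] (hn : 2 ≤ n) (hchar : (n : K) ≠ 0) :
    IsPolystable (tracePow K n n) := by
  classical
  haveI : NeZero n := ⟨by omega⟩
  haveI : Infinite K := IsAlgClosed.instInfinite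
  by_contra hnp
  set v : MvPolynomial (Fin n × Fin n) K := tracePow K n n with hv
  obtain ⟨h, a, hsum, ha0, hadm, hflag⟩ :=
    exists_isAdm_forall_weightFlag_stable_of_not_isPolystable (isHomogeneous_tracePow K n n) hnp
  set H : Matrix (Fin n × Fin n) (Fin n × Fin n) K := (h : Matrix (Fin n × Fin n) (Fin n × Fin n) K)
    with hH
  have hHdet : IsUnit H.det := by rw [hH, h.det_coe]; exact isUnit_one
  set u : MvPolynomial (Fin n × Fin n) K := linSubst (Fin n × Fin n) K H v with hu
  have huhom : u.IsHomogeneous n := linSubst_isHomogeneous _ (isHomogeneous_tracePow K n n)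
  -- the flag steps
  set F : ℝ → Submodule K (Fin n × Fin n → K) := fun r =>
    (Submodule.pi {i : Fin n × Fin n | a i < r} (fun _ => (⊥ : Submodule K K))).comap H.mulVecLin
    with hF
  have hFmem : ∀ (r : ℝ) (x : Fin n × Fin n → K), x ∈ F r ↔ ∀ i, a i < r → H.mulVec x i = 0 :=
    fun r x => mem_weightFlag_iff H a r x
  -- every step is conjugation invariant, hence one of `⊥, K·1, sl, ⊤`
  have hclass : ∀ r : ℝ, F r = ⊥ ∨ F r = K ∙ (vecI : Fin n × Fin n → K) ∨
      F r = LinearMap.ker (trLin (K := K) (n := n)) ∨ F r = ⊤ := by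
    intro r
    refine submodule_eq_of_conjVec_mem (F r) fun i j hij t x hx => ?_
    exact conjVec_mem_of_stable (m := n) (fun γ hγ x hx => hflag r γ hγ x hx) hij t hx
  -- the extreme weights `α < 0 < β`
  have hne : (Finset.univ : Finset (Fin n × Fin n)).Nonempty := Finset.univ_nonempty
  obtain ⟨imin, -, hαdef⟩ := Finset.exists_mem_eq_inf' hne a
  obtain ⟨imax, -, hβdef⟩ := Finset.exists_mem_eq_sup' hne a
  set α : ℝ := Finset.univ.inf' hne a with hα
  set β : ℝ := Finset.univ.sup' hne a with hβ
  have hαle : ∀ i, α ≤ a i := fun i => Finset.inf'_le a (Finset.mem_univ i)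
  have hleβ : ∀ i, a i ≤ β := fun i => Finset.le_sup' a (Finset.mem_univ i)
  have hβpos : 0 < β := by
    by_contra hle
    push Not at hle
    have hall : ∀ i, a i = 0 := by
      have hnonpos : ∀ i ∈ (Finset.univ : Finset (Fin n × Fin n)), a i ≤ 0 :=
        fun i _ => (hleβ i).trans hle
      have := (Finset.sum_eq_zero_iff_of_nonpos hnonpos).mp hsum
      exact fun i => this i (Finset.mem_univ i)
    exact ha0 (funext hall)
  have hαneg : α < 0 := by
    by_contra hle
    push Not at hle
    have hall : ∀ i, a i = 0 := by
      have hnonneg : ∀ i ∈ (Finset.univ : Finset (Fin n × Fin n)), 0 ≤ a i :=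
        fun i _ => hle.trans (hαle i)
      have := (Finset.sum_eq_zero_iff_of_nonneg hnonneg).mp hsum
      exact fun i => this i (Finset.mem_univ i)
    exact ha0 (funext hall)
  have hαβ : α < β := hαneg.trans hβpos
  -- the threshold `α'` just above `α`
  have hfilt : (Finset.univ.filter fun i : Fin n × Fin n => α < a i).Nonempty :=
    ⟨imax, Finset.mem_filter.mpr ⟨Finset.mem_univ _, by rw [← hβdef]; exact hαβ⟩⟩
  set α' : ℝ := (Finset.univ.filter fun i : Fin n × Fin n => α < a i).inf' hfilt a with hα'
  have hα'iff : ∀ i, a i < α' ↔ a i = α := by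
    intro i
    constructor
    · intro hi
      by_contra hne'
      have hlt : α < a i := lt_of_le_of_ne (hαle i) (Ne.symm hne')
      have : α' ≤ a i := Finset.inf'_le a (by simp [hlt])
      exact absurd hi (not_lt.mpr this)
    · intro hi
      obtain ⟨j, hj, hjeq⟩ := Finset.exists_mem_eq_inf' hfilt a
      rw [hα', hjeq, hi]
      simpa using hj
  have hαα' : α < α' := by
    have := (hα'iff imin).mpr hαdef.symm
    rwa [← hαdef] at this
  have hαimax : α < a imax := by rw [← hβdef]; exact hαβ
  have hα'imax : α' ≤ a imax :=
    Finset.inf'_le a (Finset.mem_filter.mpr ⟨Finset.mem_univ _, hαimax⟩)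
  have hα'β : α' ≤ β := by rw [hβdef]; exact hα'imax
  -- both steps `F β ⊆ F α'` are proper and non-zero
  have hFβ_bot : F β ≠ ⊥ := weightFlag_ne_bot hHdet (le_of_eq hβdef)
  have hFβ_top : F β ≠ ⊤ := weightFlag_ne_top hHdet (show a imin < β by rw [← hαdef]; exact hαβ)
  have hFα_bot : F α' ≠ ⊥ := weightFlag_ne_bot hHdet hα'imax
  have hFα_top : F α' ≠ ⊤ := weightFlag_ne_top hHdet (show a imin < α' by rw [← hαdef]; exact hαα')
  have hle : F β ≤ F α' := by
    intro x hx
    rw [hFmem] at hx ⊢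
    intro i hi
    exact hx i (by rw [(hα'iff i).mp hi]; exact hαβ)
  have h01 : (0 : Fin n) ≠ 1 := by
    intro h0
    have h' := congrArg Fin.val h0
    rw [Fin.val_one', Fin.val_zero, Nat.mod_eq_of_lt (by omega)] at h'
    exact zero_ne_one h'
  have hvecI_not_ker : (vecI : Fin n × Fin n → K) ∉ LinearMap.ker (trLin (K := K) (n := n)) := by
    rw [LinearMap.mem_ker, trLin_vecI]; exact hchar
  have hE_not_line : (vecE 0 1 : Fin n × Fin n → K) ∉ K ∙ (vecI : Fin n × Fin n → K) := by
    rw [Submodule.mem_span_singleton]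
    rintro ⟨c, hc⟩
    have := congrFun hc (0, 1)
    simp [vecI, vecE_apply, h01] at this
  -- the two steps coincide
  have heq : F β = F α' := by
    rcases hclass β with h1 | h1 | h1 | h1
    · exact absurd h1 hFβ_bot
    · rcases hclass α' with h2 | h2 | h2 | h2
      · exact absurd h2 hFα_bot
      · rw [h1, h2]
      · exfalso; apply hvecI_not_ker
        rw [← h2]; exact hle (by rw [h1]; exact Submodule.mem_span_singleton_self _)
      · exact absurd h2 hFα_top
    · rcases hclass α' with h2 | h2 | h2 | h2
      · exact absurd h2 hFα_bot
      · exfalso; apply hE_not_line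
        rw [← h2]; exact hle (by rw [h1]; exact vecE_mem_ker h01)
      · rw [h1, h2]
      · exact absurd h2 hFα_top
    · exact absurd h1 hFβ_top
  -- hence `a` takes only the values `α` and `β`
  have hHinv : ∀ i, H.mulVec (H⁻¹.mulVec (Pi.single i 1)) = Pi.single i 1 := by
    intro i
    rw [Matrix.mulVec_mulVec, Matrix.mul_nonsing_inv H hHdet, Matrix.one_mulVec]
  have htwo : ∀ i, a i < β → a i = α := by
    intro i hi
    by_contra hne'
    have hx : H⁻¹.mulVec (Pi.single i 1) ∈ F α' := by
      rw [hFmem]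
      intro j hj
      rw [hHinv, Pi.single_eq_of_ne]
      rintro rfl
      exact hne' ((hα'iff j).mp hj)
    rw [← heq, hFmem] at hx
    have := hx i hi
    rw [hHinv, Pi.single_eq_same] at this
    exact one_ne_zero this
  have hu_support : ∀ d ∈ u.support, ∑ i, (d i : ℝ) = n := by
    intro d hd
    exact_mod_cast sum_eq_of_mem_support huhom hd
  rcases hclass β with hA | hA | hB | hT
  · exact absurd hA hFβ_bot
  · /- CASE A: the step is the line `K · 1`; then `imax` is the only index of weight `β` -/
    have huniq : ∀ i, a i = β → i = imax := by
      intro i hi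
      by_contra hne'
      have hxi : H⁻¹.mulVec (Pi.single i 1) ∈ F β := by
        rw [hFmem]; intro j hj; rw [hHinv, Pi.single_eq_of_ne]; rintro rfl; exact absurd hi hj.ne
      have hxm : H⁻¹.mulVec (Pi.single imax 1) ∈ F β := by
        rw [hFmem]; intro j hj; rw [hHinv, Pi.single_eq_of_ne]; rintro rfl
        exact absurd hβdef.symm hj.ne
      rw [hA, Submodule.mem_span_singleton] at hxi hxm
      obtain ⟨c, hc⟩ := hxi
      obtain ⟨c', hc'⟩ := hxm
      have h1 : c • H.mulVec vecI = Pi.single i 1 := by rw [← Matrix.mulVec_smul, hc, hHinv]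
      have h2 : c' • H.mulVec vecI = Pi.single imax 1 := by rw [← Matrix.mulVec_smul, hc', hHinv]
      have hc0 : c ≠ 0 := by
        rintro rfl
        rw [zero_smul] at h1
        have h0 := congrFun h1 i
        rw [Pi.zero_apply, Pi.single_eq_same] at h0
        exact one_ne_zero h0.symm
      have h3 : H.mulVec vecI = c⁻¹ • Pi.single i 1 := by
        rw [← h1, smul_smul, inv_mul_cancel₀ hc0, one_smul]
      rw [h3, smul_smul] at h2
      have := congrFun h2 imax
      rw [Pi.smul_apply, Pi.single_eq_same, Pi.single_eq_of_ne (Ne.symm hne'), smul_zero] at this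
      exact zero_ne_one this
    -- admissibility: every monomial of `u` contains `x_{imax}`
    have hdiv : ∀ d ∈ u.support, d imax ≠ 0 := by
      intro d hd hzero
      have hpos := hadm d hd
      have hrw : ∀ i, a i * (d i : ℝ) = α * (d i : ℝ) := by
        intro i
        by_cases hi : i = imax
        · rw [hi, hzero]; simp
        · have : a i = α := htwo i (lt_of_le_of_ne (hleβ i) fun e => hi (huniq i e))
          rw [this]
      simp_rw [hrw] at hpos
      rw [← Finset.mul_sum, hu_support d hd] at hpos
      have : α * (n : ℝ) < 0 := mul_neg_of_neg_of_pos hαneg (by exact_mod_cast (by omega : 0 < n))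
      exact absurd hpos (not_le.mpr this)
    -- hence `v` vanishes on the hyperplane `{y : ∑ y_j (H⁻¹)_{j,imax} = 0}`
    have hvan : ∀ y : Fin n × Fin n → K, (∑ j, y j * H⁻¹ j imax) = 0 → eval y v = 0 := by
      intro y hy
      have hx0 : (Matrix.vecMul y H⁻¹) imax = 0 := by
        rw [Matrix.vecMul, dotProduct]; exact hy
      have h1 := eval_eq_zero_of_forall_mem_support hdiv hx0
      rwa [hu, eval_linSubst, Matrix.vecMul_vecMul, Matrix.nonsing_inv_mul H hHdet,
        Matrix.vecMul_one] at h1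
    obtain ⟨Y, hY, htr⟩ := exists_trace_pow_ne_zero hn hchar (fun j => H⁻¹ j imax)
    apply htr
    rw [← eval_tracePow]
    refine hvan _ ?_
    rw [← hY]
    exact Finset.sum_congr rfl fun p _ => mul_comm _ _
  · /- CASE B: the step is `sl_n`; then `imin` is the only index of weight `α` -/
    have hrow : ∀ i, a i = α → H i = H i (0, 0) • (vecI : Fin n × Fin n → K) := by
      intro i hi
      refine row_eq_smul_vecI_of_ker_le fun x hx => ?_
      rw [← hB, hFmem] at hx
      exact hx i (by rw [hi]; exact hαβ)
    have hrow0 : ∀ i, a i = α → H i (0, 0) ≠ 0 := by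
      intro i hi h0
      have hz : H i = 0 := by rw [hrow i hi, h0, zero_smul]
      have : H.det = 0 := Matrix.det_eq_zero_of_row_eq_zero i fun j => by rw [hz]; rfl
      rw [hH, h.det_coe] at this
      exact one_ne_zero this
    have huniq : ∀ i, a i = α → i = imin := by
      intro i hi
      by_contra hne'
      have hm : a imin = α := hαdef.symm
      set c := H i (0, 0) with hc
      set c' := H imin (0, 0) with hc'
      -- rows `i` and `imin` are proportional: the determinant vanishes
      have hdet : (H.updateRow imin (H imin + (-(c' / c)) • H i)).det = H.det :=
        Matrix.det_updateRow_add_smul_self H (Ne.symm hne') _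
      have hzero : H.updateRow imin (H imin + (-(c' / c)) • H i) imin = 0 := by
        rw [Matrix.updateRow_self, hrow i hi, hrow imin hm, ← hc, ← hc', smul_smul, ← add_smul]
        have hc0 : c ≠ 0 := by rw [hc]; exact hrow0 i hi
        have : c' + -(c' / c) * c = 0 := by rw [neg_mul, div_mul_cancel₀ c' hc0, add_neg_cancel]
        rw [this, zero_smul]
      have : (H.updateRow imin (H imin + (-(c' / c)) • H i)).det = 0 :=
        Matrix.det_eq_zero_of_row_eq_zero imin fun j => by rw [hzero]; rfl
      rw [hdet, hH, h.det_coe] at this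
      exact one_ne_zero this
    -- admissibility: no monomial of `u` involves `x_{imin}`
    have hcard : (Finset.univ.erase imin).card = n * n - 1 := by
      rw [Finset.card_erase_of_mem (Finset.mem_univ _), Finset.card_univ, Fintype.card_prod,
        Fintype.card_fin]
    have hothers : ∀ i ∈ Finset.univ.erase imin, a i = β := by
      intro i hi
      rw [Finset.mem_erase] at hi
      by_contra hne'
      exact hi.1 (huniq i (htwo i (lt_of_le_of_ne (hleβ i) hne')))
    have hsum' : α + ((n * n - 1 : ℕ) : ℝ) * β = 0 := by
      rw [← Finset.add_sum_erase _ _ (Finset.mem_univ imin), ← hαdef,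
        Finset.sum_congr rfl hothers, Finset.sum_const, hcard, nsmul_eq_mul] at hsum
      exact hsum
    have hnotdiv : ∀ d ∈ u.support, d imin = 0 := by
      intro d hd
      by_contra hne0
      have hpos := hadm d hd
      have hdeg := hu_support d hd
      rw [← Finset.add_sum_erase _ _ (Finset.mem_univ imin)] at hpos hdeg
      have hrw : ∑ i ∈ Finset.univ.erase imin, a i * (d i : ℝ) =
          β * ∑ i ∈ Finset.univ.erase imin, (d i : ℝ) := by
        rw [Finset.mul_sum]
        exact Finset.sum_congr rfl fun i hi => by rw [hothers i hi]
      rw [hrw, ← hαdef] at hpos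
      set S : ℝ := ∑ i ∈ Finset.univ.erase imin, (d i : ℝ) with hS
      have hd1 : (1 : ℝ) ≤ d imin := by exact_mod_cast Nat.pos_of_ne_zero hne0
      have hn2 : (2 : ℝ) ≤ n := by exact_mod_cast hn
      have hN : ((n * n - 1 : ℕ) : ℝ) = (n : ℝ) * n - 1 := by
        rw [Nat.cast_sub (Nat.one_le_iff_ne_zero.mpr (Nat.mul_ne_zero (by omega) (by omega))),
          Nat.cast_mul, Nat.cast_one]
      rw [hN] at hsum'
      -- `α d + β S = β (n - n² d) < 0`
      have hval : α * (d imin : ℝ) + β * S = β * ((n : ℝ) - n * n * d imin) := by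
        have hα' : α = -(((n : ℝ) * n - 1) * β) := by linarith
        rw [hα', show S = (n : ℝ) - d imin by linarith]
        ring
      have hneg : β * ((n : ℝ) - n * n * d imin) < 0 := by
        apply mul_neg_of_pos_of_neg hβpos
        nlinarith
      rw [hval] at hpos
      exact absurd hpos (not_le.mpr hneg)
    -- hence `u` vanishes on the axis `K e_{imin}`, i.e. `v` on `K · (row imin of H) = K · 1`
    have hv0 : eval (vecI : Fin n × Fin n → K) v = 0 := by
      set c₀ := H imin (0, 0) with hc₀
      have hc₀0 : c₀ ≠ 0 := hrow0 imin hαdef.symm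
      have h1 := eval_single_eq_zero_of_forall_mem_support huhom (by omega) hnotdiv c₀⁻¹
      rw [hu, eval_linSubst, Matrix.single_vecMul] at h1
      have hrowI : H.row imin = c₀ • (vecI : Fin n × Fin n → K) := hrow imin hαdef.symm
      rwa [hrowI, smul_smul, inv_mul_cancel₀ hc₀0, one_smul] at h1
    have hvI : eval (vecI : Fin n × Fin n → K) v = n := by
      have := eval_tracePow (1 : Matrix (Fin n) (Fin n) K) n
      rw [one_pow, Matrix.trace_one, Fintype.card_fin] at this
      rw [← this]
      rfl
    rw [hvI] at hv0
    exact hchar hv0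
  · exact absurd hT hFβ_top

end Main

end MS2001TracePowPolystable

/-! ## §8. The exported statements -/

section Export

open MS2001TracePowPolystable

/-- **GCT I §4.1 Remark — the Thm. 4.6 analogue holds for `trace(Y^m)` whenever `m ≥ 2` and
`m ≠ 0` in the algebraically closed field `K`**: the `SL_{m²}(K)`-orbit of `trace(Y^m)` is
Zariski closed (`IsPolystable (tracePow K m m)`). Sharp in `m` versus the characteristic: false for
`m = char K` (`MS2001_rem_4_1_trace_thm_4_6_analogue_false_charP`).
[cite: MulmuleySohoniSIAM2001, §4.1 Remark (AV p.16, all.txt L1122–1124) and Thm. 4.6 (AV p.15)] -/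
theorem MS2001_rem_4_1_trace_thm_4_6_analogue (K : Type) [Field K] [IsAlgClosed K] {m : ℕ}
    (hm : 2 ≤ m) (hchar : (m : K) ≠ 0) : IsPolystable (tracePow K m m) :=
  isPolystable_tracePow hm hchar

/-- **The Thm. 4.6 analogue for `trace(Y^m)` over every algebraically closed field of
characteristic `0`, all `m ≥ 2`.** [cite: MulmuleySohoniSIAM2001, §4.1 Remark (AV p.16, all.txt L1122–1124)] -/
theorem MS2001_rem_4_1_trace_thm_4_6_analogue_of_charZero (K : Type) [Field K] [IsAlgClosed K]
    [CharZero K] {m : ℕ} (hm : 2 ≤ m) : IsPolystable (tracePow K m m) :=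
  isPolystable_tracePow hm (by exact_mod_cast (show m ≠ 0 by omega))

/-- **The Thm. 4.6 analogue for `trace(Y^m)` over `ℂ`, all `m ≥ 2`** (the case `m = 2` is the
companion file's `MS2001_rem_4_1_trace_thm_4_6_analogue_two_complex`).
[cite: MulmuleySohoniSIAM2001, §4.1 Remark (AV p.16, all.txt L1122–1124)] -/
theorem MS2001_rem_4_1_trace_thm_4_6_analogue_complex {m : ℕ} (hm : 2 ≤ m) :
    IsPolystable (tracePow ℂ m m) :=
  MS2001_rem_4_1_trace_thm_4_6_analogue_of_charZero ℂ hm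

end Export

/-! ## §9. All exponents: `trace(Y^m)` on `n × n` matrices is polystable for `n ≥ 3`, `2 ≤ m < n²`
(appended 2026-08-31, prover seat of route GeneratorObstructions; consumer: the wide regime of
`Summits/ValiantsHypothesis/.../GeneratorObstructionsPowGenDegreeQPWideAtoms`, which needs an
`SL_{n²}`-invariant not vanishing at `tr X_n^m` for `n > m`).  The §7 argument is verbatim except at
two places: the degree of the form is `m` (not `n`) in the two admissibility computations, and the
hyperplane `sl_n` is excluded by the traceless DIAGONAL matrix `diag(1, 1, -2, 0, …, 0)`
(`trace = 2 + (-2)^m ≠ 0` in characteristic `0`, any `m ≥ 2`) instead of the cyclic shift (whose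
`m`-th power has trace `n·[n ∣ m]`).  For `n = 2` and odd `m` the hyperplane argument is not
available (`trace(Y) = 0 ⇒ Y² ∈ K·1 ⇒ trace(Y^m) = 0`: `tr Y` divides `tr Y^m`; for `m = 3` the
form `tr(Y_2³) = ¼ s³ + ¾ s v² + 3 s pq`, `s = tr Y`, is indeed a nullform — the one-parameter
subgroup with weights `(3, -1, -1, -1)` on `(s, v, p, q)` kills it), whence the hypothesis `n ≥ 3`
(no claim is made here about `n = 2`, `m ≥ 5`). -/

namespace MS2001TracePowPolystable

section GeneralExponent

variable {K : Type} [Field K] {n : ℕ}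

/-- `2 + (-2)^m ≠ 0` in characteristic `0` for `m ≥ 2`. [folklore] -/
private theorem two_add_neg_two_pow_ne_zero [CharZero K] {m : ℕ} (hm : 2 ≤ m) :
    (1 : K) + 1 + (-2 : K) ^ m ≠ 0 := by
  have hz : ((2 + (-2) ^ m : ℤ) : K) = (1 : K) + 1 + (-2 : K) ^ m := by push_cast; ring
  rw [← hz, Int.cast_ne_zero]
  have h4 : (4 : ℤ) ≤ 2 ^ m := by
    calc (4 : ℤ) = 2 ^ 2 := by norm_num
      _ ≤ 2 ^ m := pow_le_pow_right₀ (by norm_num) hm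
  rcases Nat.even_or_odd m with he | ho
  · rw [he.neg_pow]; positivity
  · rw [ho.neg_pow]; omega

/-- **`trace(Y^m)` vanishes on no hyperplane of `M_n(K)`** (`n ≥ 3`, `m ≥ 2`, characteristic `0`):
for every coefficient vector `b` there is a matrix `Y` with `∑_p b_p Y_p = 0` and `trace(Y^m) ≠ 0` —
a rank-one idempotent (trace `1`) in the hyperplane, or, when the hyperplane is `sl_n`, the traceless
diagonal matrix `diag(1, 1, -2, 0, …, 0)`. [folklore] -/
private theorem exists_trace_pow_ne_zero_of_three_le [CharZero K] (hn : 3 ≤ n) {m : ℕ} (hm : 2 ≤ m)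
    (b : Fin n × Fin n → K) :
    ∃ Y : Matrix (Fin n) (Fin n) K, (∑ p : Fin n × Fin n, b p * Y p.1 p.2) = 0 ∧
      (Y ^ m).trace ≠ 0 := by
  classical
  haveI : NeZero n := ⟨by omega⟩
  -- an idempotent of trace one in the hyperplane suffices
  have key : ∀ Y : Matrix (Fin n) (Fin n) K, Y * Y = Y → Y.trace = 1 →
      (∑ p : Fin n × Fin n, b p * Y p.1 p.2) = 0 →
      ∃ Y : Matrix (Fin n) (Fin n) K, (∑ p : Fin n × Fin n, b p * Y p.1 p.2) = 0 ∧
        (Y ^ m).trace ≠ 0 := by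
    intro Y hY htr hb
    refine ⟨Y, hb, ?_⟩
    rw [pow_eq_self_of_mul_self hY (by omega : 1 ≤ m), htr]
    exact one_ne_zero
  by_cases hoff : ∃ k l : Fin n, k ≠ l ∧ b (k, l) ≠ 0
  · -- (i) an off-diagonal coefficient: `Y = E_{ll} - (b_{ll}/b_{kl}) E_{kl}`
    obtain ⟨k, l, hkl, hbkl⟩ := hoff
    set c : K := -(b (l, l) / b (k, l)) with hc
    have h1 : Matrix.single l l (1 : K) * Matrix.single k l c = 0 :=
      Matrix.single_mul_single_of_ne 1 l l k (Ne.symm hkl) c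
    have h2 : Matrix.single k l c * Matrix.single k l c = 0 :=
      Matrix.single_mul_single_of_ne c k l k (Ne.symm hkl) c
    refine key (Matrix.single l l 1 + Matrix.single k l c) ?_ ?_ ?_
    · rw [add_mul, mul_add, mul_add, Matrix.single_mul_single_same, h1, Matrix.single_mul_single_same,
        h2, mul_one, mul_one, add_zero, add_zero]
    · simp only [Matrix.trace, Matrix.diag, Matrix.add_apply, Matrix.single_apply, and_self,
        Finset.sum_add_distrib, Finset.sum_ite_eq, Finset.mem_univ, if_true]
      rw [Finset.sum_eq_zero, add_zero]
      intro i _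
      rw [if_neg]
      rintro ⟨rfl, rfl⟩
      exact hkl rfl
    · simp only [Matrix.add_apply, mul_add, Finset.sum_add_distrib, sum_mul_single]
      rw [hc, mul_one]
      field_simp
      ring
  · push Not at hoff
    -- from here on `b` is supported on the diagonal
    have hpair : ∀ Y : Matrix (Fin n) (Fin n) K,
        (∑ p : Fin n × Fin n, b p * Y p.1 p.2) = ∑ a : Fin n, b (a, a) * Y a a := by
      intro Y
      rw [Fintype.sum_prod_type]
      refine Finset.sum_congr rfl fun a _ => ?_
      rw [Finset.sum_eq_single a]
      · intro d _ hd
        rw [hoff a d (Ne.symm hd), zero_mul]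
      · intro h; exact absurd (Finset.mem_univ _) h
    by_cases hne : ∃ k l : Fin n, b (k, k) ≠ b (l, l)
    · -- (ii) two distinct diagonal coefficients: the rank-one idempotent `p qᵀ`,
      -- `p = e_k + e_l`, `q = c e_k + (1 - c) e_l`, `c = b_{ll} / (b_{ll} - b_{kk})`
      obtain ⟨k, l, hbkl⟩ := hne
      have hkl : k ≠ l := by rintro rfl; exact hbkl rfl
      set c : K := b (l, l) / (b (l, l) - b (k, k)) with hc
      set p : Fin n → K := Pi.single k 1 + Pi.single l 1 with hp
      set q : Fin n → K := Pi.single k c + Pi.single l (1 - c) with hq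
      have hpq_apply : ∀ a, p a * q a = (if a = k then c else 0) + (if a = l then 1 - c else 0) := by
        intro a
        by_cases hak : a = k
        · subst hak
          simp [hp, hq, hkl]
        · by_cases hal : a = l
          · subst hal
            simp [hp, hq, hak]
          · simp [hp, hq, hak, hal]
      have hqp : q ⬝ᵥ p = 1 := by
        rw [dotProduct]
        simp_rw [mul_comm (q _) (p _), hpq_apply]
        rw [Finset.sum_add_distrib, Finset.sum_ite_eq', Finset.sum_ite_eq']
        simp
      have hpq : p ⬝ᵥ q = 1 := by rw [dotProduct_comm]; exact hqp
      refine key (Matrix.vecMulVec p q) ?_ ?_ ?_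
      · rw [Matrix.vecMulVec_mul_vecMulVec, hqp, one_smul]
      · rw [Matrix.trace_vecMulVec, hpq]
      · rw [hpair]
        simp_rw [Matrix.vecMulVec_apply, hpq_apply, mul_add, Finset.sum_add_distrib, mul_ite,
          mul_zero, Finset.sum_ite_eq', Finset.mem_univ, if_true]
        have hsub : b (l, l) - b (k, k) ≠ 0 := sub_ne_zero.mpr (Ne.symm hbkl)
        rw [hc]
        field_simp
        ring
    · -- (iii) `b = b₀ · 1`: the hyperplane is `sl_n` (or everything); take `diag(1, 1, -2, 0, …)`
      push Not at hne
      set i0 : Fin n := ⟨0, by omega⟩ with hi0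
      set i1 : Fin n := ⟨1, by omega⟩ with hi1
      set i2 : Fin n := ⟨2, by omega⟩ with hi2
      have h01 : i0 ≠ i1 := by rw [hi0, hi1]; intro h; exact absurd (congrArg Fin.val h) (by norm_num)
      have h02 : i0 ≠ i2 := by rw [hi0, hi2]; intro h; exact absurd (congrArg Fin.val h) (by norm_num)
      have h12 : i1 ≠ i2 := by rw [hi1, hi2]; intro h; exact absurd (congrArg Fin.val h) (by norm_num)
      set w : Fin n → K := Pi.single i0 1 + Pi.single i1 1 + Pi.single i2 (-2) with hw
      have hwpow : ∀ a : Fin n, w a ^ m =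
          ((Pi.single i0 (1 : K) + Pi.single i1 (1 : K) + Pi.single i2 ((-2 : K) ^ m) :
            Fin n → K)) a := by
        intro a
        simp only [hw, Pi.add_apply, Pi.single_apply]
        by_cases ha0 : a = i0
        · subst ha0; simp [h01, h02]
        · by_cases ha1 : a = i1
          · subst ha1; simp [Ne.symm h01, h12]
          · by_cases ha2 : a = i2
            · subst ha2; simp [Ne.symm h02, Ne.symm h12]
            · simp [ha0, ha1, ha2, zero_pow (by omega : m ≠ 0)]
      refine ⟨Matrix.diagonal w, ?_, ?_⟩
      · rw [hpair]
        have hb : ∀ a, b (a, a) = b (i0, i0) := fun a => hne a i0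
        simp_rw [hb, Matrix.diagonal_apply_eq, ← Finset.mul_sum]
        have hsumw : ∑ a : Fin n, w a = 0 := by
          simp only [hw, Pi.add_apply, Finset.sum_add_distrib, Finset.sum_pi_single',
            Finset.mem_univ, if_true]
          norm_num
        rw [hsumw, mul_zero]
      · rw [Matrix.diagonal_pow, Matrix.trace_diagonal]
        simp_rw [Pi.pow_apply, hwpow]
        simp only [Pi.add_apply, Finset.sum_add_distrib, Finset.sum_pi_single', Finset.mem_univ,
          if_true]
        exact two_add_neg_two_pow_ne_zero hm

/-- **`trace(Y^m)` is polystable for every `n ≥ 3` and every exponent `2 ≤ m < n²`** over an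
algebraically closed field of characteristic `0`: the `SL_{n²}(K)`-orbit of `tracePow K n m` is
Zariski closed.  Proof: Kempf's criterion exactly as in `isPolystable_tracePow` (§7) — the flag of
an admissible optimal pair is conjugation invariant, hence one proper step `K·1` or `sl_n`; the step
`K·1` would make `trace(Y^m)` vanish on a hyperplane (`exists_trace_pow_ne_zero_of_three_le`), the
step `sl_n` would make `trace((Y + c·1)^m)` independent of `c` (false at `Y = 0`).  The two
admissibility computations use `deg = m < n²`. [cite: MulmuleySohoniSIAM2001, §4.1 Remark (AV p.16, all.txt L1122–1124) and Thm. 4.6 (AV p.15)]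
[cite: Kempf1978, Cor. 4.4] -/
theorem isPolystable_tracePow_of_three_le [IsAlgClosed K] [CharZero K] (hn : 3 ≤ n) {m : ℕ}
    (hm : 2 ≤ m) (hmn : m < n * n) : IsPolystable (tracePow K n m) := by
  classical
  haveI : NeZero n := ⟨by omega⟩
  haveI : Infinite K := IsAlgClosed.instInfinite
  have hchar : (n : K) ≠ 0 := by exact_mod_cast (show n ≠ 0 by omega)
  by_contra hnp
  set v : MvPolynomial (Fin n × Fin n) K := tracePow K n m with hv
  obtain ⟨h, a, hsum, ha0, hadm, hflag⟩ :=
    exists_isAdm_forall_weightFlag_stable_of_not_isPolystable (isHomogeneous_tracePow K n m) hnp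
  set H : Matrix (Fin n × Fin n) (Fin n × Fin n) K := (h : Matrix (Fin n × Fin n) (Fin n × Fin n) K)
    with hH
  have hHdet : IsUnit H.det := by rw [hH, h.det_coe]; exact isUnit_one
  set u : MvPolynomial (Fin n × Fin n) K := linSubst (Fin n × Fin n) K H v with hu
  have huhom : u.IsHomogeneous m := linSubst_isHomogeneous _ (isHomogeneous_tracePow K n m)
  -- the flag steps
  set F : ℝ → Submodule K (Fin n × Fin n → K) := fun r =>
    (Submodule.pi {i : Fin n × Fin n | a i < r} (fun _ => (⊥ : Submodule K K))).comap H.mulVecLin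
    with hF
  have hFmem : ∀ (r : ℝ) (x : Fin n × Fin n → K), x ∈ F r ↔ ∀ i, a i < r → H.mulVec x i = 0 :=
    fun r x => mem_weightFlag_iff H a r x
  -- every step is conjugation invariant, hence one of `⊥, K·1, sl, ⊤`
  have hclass : ∀ r : ℝ, F r = ⊥ ∨ F r = K ∙ (vecI : Fin n × Fin n → K) ∨
      F r = LinearMap.ker (trLin (K := K) (n := n)) ∨ F r = ⊤ := by
    intro r
    refine submodule_eq_of_conjVec_mem (F r) fun i j hij t x hx => ?_
    exact conjVec_mem_of_stable (m := m) (fun γ hγ x hx => hflag r γ hγ x hx) hij t hx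
  -- the extreme weights `α < 0 < β`
  have hne : (Finset.univ : Finset (Fin n × Fin n)).Nonempty := Finset.univ_nonempty
  obtain ⟨imin, -, hαdef⟩ := Finset.exists_mem_eq_inf' hne a
  obtain ⟨imax, -, hβdef⟩ := Finset.exists_mem_eq_sup' hne a
  set α : ℝ := Finset.univ.inf' hne a with hα
  set β : ℝ := Finset.univ.sup' hne a with hβ
  have hαle : ∀ i, α ≤ a i := fun i => Finset.inf'_le a (Finset.mem_univ i)
  have hleβ : ∀ i, a i ≤ β := fun i => Finset.le_sup' a (Finset.mem_univ i)
  have hβpos : 0 < β := by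
    by_contra hle
    push Not at hle
    have hall : ∀ i, a i = 0 := by
      have hnonpos : ∀ i ∈ (Finset.univ : Finset (Fin n × Fin n)), a i ≤ 0 :=
        fun i _ => (hleβ i).trans hle
      have := (Finset.sum_eq_zero_iff_of_nonpos hnonpos).mp hsum
      exact fun i => this i (Finset.mem_univ i)
    exact ha0 (funext hall)
  have hαneg : α < 0 := by
    by_contra hle
    push Not at hle
    have hall : ∀ i, a i = 0 := by
      have hnonneg : ∀ i ∈ (Finset.univ : Finset (Fin n × Fin n)), 0 ≤ a i :=
        fun i _ => hle.trans (hαle i)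
      have := (Finset.sum_eq_zero_iff_of_nonneg hnonneg).mp hsum
      exact fun i => this i (Finset.mem_univ i)
    exact ha0 (funext hall)
  have hαβ : α < β := hαneg.trans hβpos
  -- the threshold `α'` just above `α`
  have hfilt : (Finset.univ.filter fun i : Fin n × Fin n => α < a i).Nonempty :=
    ⟨imax, Finset.mem_filter.mpr ⟨Finset.mem_univ _, by rw [← hβdef]; exact hαβ⟩⟩
  set α' : ℝ := (Finset.univ.filter fun i : Fin n × Fin n => α < a i).inf' hfilt a with hα'
  have hα'iff : ∀ i, a i < α' ↔ a i = α := by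
    intro i
    constructor
    · intro hi
      by_contra hne'
      have hlt : α < a i := lt_of_le_of_ne (hαle i) (Ne.symm hne')
      have : α' ≤ a i := Finset.inf'_le a (by simp [hlt])
      exact absurd hi (not_lt.mpr this)
    · intro hi
      obtain ⟨j, hj, hjeq⟩ := Finset.exists_mem_eq_inf' hfilt a
      rw [hα', hjeq, hi]
      simpa using hj
  have hαα' : α < α' := by
    have := (hα'iff imin).mpr hαdef.symm
    rwa [← hαdef] at this
  have hαimax : α < a imax := by rw [← hβdef]; exact hαβ
  have hα'imax : α' ≤ a imax :=
    Finset.inf'_le a (Finset.mem_filter.mpr ⟨Finset.mem_univ _, hαimax⟩)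
  have hα'β : α' ≤ β := by rw [hβdef]; exact hα'imax
  -- both steps `F β ⊆ F α'` are proper and non-zero
  have hFβ_bot : F β ≠ ⊥ := weightFlag_ne_bot hHdet (le_of_eq hβdef)
  have hFβ_top : F β ≠ ⊤ := weightFlag_ne_top hHdet (show a imin < β by rw [← hαdef]; exact hαβ)
  have hFα_bot : F α' ≠ ⊥ := weightFlag_ne_bot hHdet hα'imax
  have hFα_top : F α' ≠ ⊤ := weightFlag_ne_top hHdet (show a imin < α' by rw [← hαdef]; exact hαα')
  have hle : F β ≤ F α' := by
    intro x hx
    rw [hFmem] at hx ⊢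
    intro i hi
    exact hx i (by rw [(hα'iff i).mp hi]; exact hαβ)
  have h01 : (0 : Fin n) ≠ 1 := by
    intro h0
    have h' := congrArg Fin.val h0
    rw [Fin.val_one', Fin.val_zero, Nat.mod_eq_of_lt (by omega)] at h'
    exact zero_ne_one h'
  have hvecI_not_ker : (vecI : Fin n × Fin n → K) ∉ LinearMap.ker (trLin (K := K) (n := n)) := by
    rw [LinearMap.mem_ker, trLin_vecI]; exact hchar
  have hE_not_line : (vecE 0 1 : Fin n × Fin n → K) ∉ K ∙ (vecI : Fin n × Fin n → K) := by
    rw [Submodule.mem_span_singleton]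
    rintro ⟨c, hc⟩
    have := congrFun hc (0, 1)
    simp [vecI, vecE_apply, h01] at this
  -- the two steps coincide
  have heq : F β = F α' := by
    rcases hclass β with h1 | h1 | h1 | h1
    · exact absurd h1 hFβ_bot
    · rcases hclass α' with h2 | h2 | h2 | h2
      · exact absurd h2 hFα_bot
      · rw [h1, h2]
      · exfalso; apply hvecI_not_ker
        rw [← h2]; exact hle (by rw [h1]; exact Submodule.mem_span_singleton_self _)
      · exact absurd h2 hFα_top
    · rcases hclass α' with h2 | h2 | h2 | h2
      · exact absurd h2 hFα_bot
      · exfalso; apply hE_not_line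
        rw [← h2]; exact hle (by rw [h1]; exact vecE_mem_ker h01)
      · rw [h1, h2]
      · exact absurd h2 hFα_top
    · exact absurd h1 hFβ_top
  -- hence `a` takes only the values `α` and `β`
  have hHinv : ∀ i, H.mulVec (H⁻¹.mulVec (Pi.single i 1)) = Pi.single i 1 := by
    intro i
    rw [Matrix.mulVec_mulVec, Matrix.mul_nonsing_inv H hHdet, Matrix.one_mulVec]
  have htwo : ∀ i, a i < β → a i = α := by
    intro i hi
    by_contra hne'
    have hx : H⁻¹.mulVec (Pi.single i 1) ∈ F α' := by
      rw [hFmem]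
      intro j hj
      rw [hHinv, Pi.single_eq_of_ne]
      rintro rfl
      exact hne' ((hα'iff j).mp hj)
    rw [← heq, hFmem] at hx
    have := hx i hi
    rw [hHinv, Pi.single_eq_same] at this
    exact one_ne_zero this
  have hu_support : ∀ d ∈ u.support, ∑ i, (d i : ℝ) = m := by
    intro d hd
    exact_mod_cast sum_eq_of_mem_support huhom hd
  rcases hclass β with hA | hA | hB | hT
  · exact absurd hA hFβ_bot
  · /- CASE A: the step is the line `K · 1`; then `imax` is the only index of weight `β` -/
    have huniq : ∀ i, a i = β → i = imax := by
      intro i hi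
      by_contra hne'
      have hxi : H⁻¹.mulVec (Pi.single i 1) ∈ F β := by
        rw [hFmem]; intro j hj; rw [hHinv, Pi.single_eq_of_ne]; rintro rfl; exact absurd hi hj.ne
      have hxm : H⁻¹.mulVec (Pi.single imax 1) ∈ F β := by
        rw [hFmem]; intro j hj; rw [hHinv, Pi.single_eq_of_ne]; rintro rfl
        exact absurd hβdef.symm hj.ne
      rw [hA, Submodule.mem_span_singleton] at hxi hxm
      obtain ⟨c, hc⟩ := hxi
      obtain ⟨c', hc'⟩ := hxm
      have h1 : c • H.mulVec vecI = Pi.single i 1 := by rw [← Matrix.mulVec_smul, hc, hHinv]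
      have h2 : c' • H.mulVec vecI = Pi.single imax 1 := by rw [← Matrix.mulVec_smul, hc', hHinv]
      have hc0 : c ≠ 0 := by
        rintro rfl
        rw [zero_smul] at h1
        have h0 := congrFun h1 i
        rw [Pi.zero_apply, Pi.single_eq_same] at h0
        exact one_ne_zero h0.symm
      have h3 : H.mulVec vecI = c⁻¹ • Pi.single i 1 := by
        rw [← h1, smul_smul, inv_mul_cancel₀ hc0, one_smul]
      rw [h3, smul_smul] at h2
      have := congrFun h2 imax
      rw [Pi.smul_apply, Pi.single_eq_same, Pi.single_eq_of_ne (Ne.symm hne'), smul_zero] at this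
      exact zero_ne_one this
    -- admissibility: every monomial of `u` contains `x_{imax}`
    have hdiv : ∀ d ∈ u.support, d imax ≠ 0 := by
      intro d hd hzero
      have hpos := hadm d hd
      have hrw : ∀ i, a i * (d i : ℝ) = α * (d i : ℝ) := by
        intro i
        by_cases hi : i = imax
        · rw [hi, hzero]; simp
        · have : a i = α := htwo i (lt_of_le_of_ne (hleβ i) fun e => hi (huniq i e))
          rw [this]
      simp_rw [hrw] at hpos
      rw [← Finset.mul_sum, hu_support d hd] at hpos
      have : α * (m : ℝ) < 0 := mul_neg_of_neg_of_pos hαneg (by exact_mod_cast (by omega : 0 < m))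
      exact absurd hpos (not_le.mpr this)
    -- hence `v` vanishes on the hyperplane `{y : ∑ y_j (H⁻¹)_{j,imax} = 0}`
    have hvan : ∀ y : Fin n × Fin n → K, (∑ j, y j * H⁻¹ j imax) = 0 → eval y v = 0 := by
      intro y hy
      have hx0 : (Matrix.vecMul y H⁻¹) imax = 0 := by
        rw [Matrix.vecMul, dotProduct]; exact hy
      have h1 := eval_eq_zero_of_forall_mem_support hdiv hx0
      rwa [hu, eval_linSubst, Matrix.vecMul_vecMul, Matrix.nonsing_inv_mul H hHdet,
        Matrix.vecMul_one] at h1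
    obtain ⟨Y, hY, htr⟩ := exists_trace_pow_ne_zero_of_three_le hn hm (fun j => H⁻¹ j imax)
    apply htr
    rw [← eval_tracePow]
    refine hvan _ ?_
    rw [← hY]
    exact Finset.sum_congr rfl fun p _ => mul_comm _ _
  · /- CASE B: the step is `sl_n`; then `imin` is the only index of weight `α` -/
    have hrow : ∀ i, a i = α → H i = H i (0, 0) • (vecI : Fin n × Fin n → K) := by
      intro i hi
      refine row_eq_smul_vecI_of_ker_le fun x hx => ?_
      rw [← hB, hFmem] at hx
      exact hx i (by rw [hi]; exact hαβ)
    have hrow0 : ∀ i, a i = α → H i (0, 0) ≠ 0 := by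
      intro i hi h0
      have hz : H i = 0 := by rw [hrow i hi, h0, zero_smul]
      have : H.det = 0 := Matrix.det_eq_zero_of_row_eq_zero i fun j => by rw [hz]; rfl
      rw [hH, h.det_coe] at this
      exact one_ne_zero this
    have huniq : ∀ i, a i = α → i = imin := by
      intro i hi
      by_contra hne'
      have hm' : a imin = α := hαdef.symm
      set c := H i (0, 0) with hc
      set c' := H imin (0, 0) with hc'
      -- rows `i` and `imin` are proportional: the determinant vanishes
      have hdet : (H.updateRow imin (H imin + (-(c' / c)) • H i)).det = H.det :=
        Matrix.det_updateRow_add_smul_self H (Ne.symm hne') _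
      have hzero : H.updateRow imin (H imin + (-(c' / c)) • H i) imin = 0 := by
        rw [Matrix.updateRow_self, hrow i hi, hrow imin hm', ← hc, ← hc', smul_smul, ← add_smul]
        have hc0 : c ≠ 0 := by rw [hc]; exact hrow0 i hi
        have : c' + -(c' / c) * c = 0 := by rw [neg_mul, div_mul_cancel₀ c' hc0, add_neg_cancel]
        rw [this, zero_smul]
      have : (H.updateRow imin (H imin + (-(c' / c)) • H i)).det = 0 :=
        Matrix.det_eq_zero_of_row_eq_zero imin fun j => by rw [hzero]; rfl
      rw [hdet, hH, h.det_coe] at this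
      exact one_ne_zero this
    -- admissibility: no monomial of `u` involves `x_{imin}`
    have hcard : (Finset.univ.erase imin).card = n * n - 1 := by
      rw [Finset.card_erase_of_mem (Finset.mem_univ _), Finset.card_univ, Fintype.card_prod,
        Fintype.card_fin]
    have hothers : ∀ i ∈ Finset.univ.erase imin, a i = β := by
      intro i hi
      rw [Finset.mem_erase] at hi
      by_contra hne'
      exact hi.1 (huniq i (htwo i (lt_of_le_of_ne (hleβ i) hne')))
    have hsum' : α + ((n * n - 1 : ℕ) : ℝ) * β = 0 := by
      rw [← Finset.add_sum_erase _ _ (Finset.mem_univ imin), ← hαdef,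
        Finset.sum_congr rfl hothers, Finset.sum_const, hcard, nsmul_eq_mul] at hsum
      exact hsum
    have hnotdiv : ∀ d ∈ u.support, d imin = 0 := by
      intro d hd
      by_contra hne0
      have hpos := hadm d hd
      have hdeg := hu_support d hd
      rw [← Finset.add_sum_erase _ _ (Finset.mem_univ imin)] at hpos hdeg
      have hrw : ∑ i ∈ Finset.univ.erase imin, a i * (d i : ℝ) =
          β * ∑ i ∈ Finset.univ.erase imin, (d i : ℝ) := by
        rw [Finset.mul_sum]
        exact Finset.sum_congr rfl fun i hi => by rw [hothers i hi]
      rw [hrw, ← hαdef] at hpos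
      set S : ℝ := ∑ i ∈ Finset.univ.erase imin, (d i : ℝ) with hS
      have hd1 : (1 : ℝ) ≤ d imin := by exact_mod_cast Nat.pos_of_ne_zero hne0
      have hn2 : (2 : ℝ) ≤ n := by exact_mod_cast (show 2 ≤ n by omega)
      have hmn' : (m : ℝ) < (n : ℝ) * n := by exact_mod_cast hmn
      have hN : ((n * n - 1 : ℕ) : ℝ) = (n : ℝ) * n - 1 := by
        rw [Nat.cast_sub (Nat.one_le_iff_ne_zero.mpr (Nat.mul_ne_zero (by omega) (by omega))),
          Nat.cast_mul, Nat.cast_one]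
      rw [hN] at hsum'
      -- `α d + β S = β (m - n² d) < 0`
      have hval : α * (d imin : ℝ) + β * S = β * ((m : ℝ) - n * n * d imin) := by
        have hα' : α = -(((n : ℝ) * n - 1) * β) := by linarith
        rw [hα', show S = (m : ℝ) - d imin by linarith]
        ring
      have hneg : β * ((m : ℝ) - n * n * d imin) < 0 := by
        apply mul_neg_of_pos_of_neg hβpos
        nlinarith
      rw [hval] at hpos
      exact absurd hpos (not_le.mpr hneg)
    -- hence `u` vanishes on the axis `K e_{imin}`, i.e. `v` on `K · (row imin of H) = K · 1`
    have hv0 : eval (vecI : Fin n × Fin n → K) v = 0 := by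
      set c₀ := H imin (0, 0) with hc₀
      have hc₀0 : c₀ ≠ 0 := hrow0 imin hαdef.symm
      have h1 := eval_single_eq_zero_of_forall_mem_support huhom (by omega) hnotdiv c₀⁻¹
      rw [hu, eval_linSubst, Matrix.single_vecMul] at h1
      have hrowI : H.row imin = c₀ • (vecI : Fin n × Fin n → K) := hrow imin hαdef.symm
      rwa [hrowI, smul_smul, inv_mul_cancel₀ hc₀0, one_smul] at h1
    have hvI : eval (vecI : Fin n × Fin n → K) v = n := by
      have := eval_tracePow (1 : Matrix (Fin n) (Fin n) K) m
      rw [one_pow, Matrix.trace_one, Fintype.card_fin] at this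
      rw [← this]
      rfl
    rw [hvI] at hv0
    exact hchar hv0
  · exact absurd hT hFβ_top

end GeneralExponent

end MS2001TracePowPolystable

section ExportGeneral

open MS2001TracePowPolystable

/-- **`trace(Y^m)` on `n × n` matrices is polystable over `ℂ` for all `n ≥ 3`, `2 ≤ m < n²`** (in
particular for every exponent `2 ≤ m < n`: the power traces `tr X_n^m` of the quasi-polynomial window
of route GeneratorObstructions' K2 have closed `SL_{n²}(ℂ)`-orbits, hence nonvanishing invariants).
Ours, by the Kempf route of the §4.1 Remark; the print treats `n = m` only.
[cite: MulmuleySohoniSIAM2001, §4.1 Remark (AV p.16, all.txt L1122–1124)] -/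
theorem tracePow_isPolystable_complex_of_three_le {n m : ℕ} (hn : 3 ≤ n) (hm : 2 ≤ m)
    (hmn : m < n * n) : IsPolystable (tracePow ℂ n m) :=
  isPolystable_tracePow_of_three_le hn hm hmn

end ExportGeneral

end Literature.Computability.AlgebraicComplexity
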